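import Mathlib
import Literature.MathematicalPhysics.QuantumFieldTheory.Balaban1983to89.B16Exp198
import Literature.MathematicalPhysics.QuantumFieldTheory.Balaban1983to89.B16Cor3

/-!
# `Balaban1983to89.B16Ineq197` — the activity estimates (1.92)–(1.96) ⇒ (1.97) of T. Bałaban, *Large field
renormalization. II. Localization, exponentiation, and bounds for the 𝐑 operation*, Commun. Math. Phys. **122**,
355–392 (1989) [Balaban1989LargeFieldII] (cell paper B16; PDF held `paper:balaban1989-cmp122-large-field-ii`, journal
page = PDF page + 354), pp. 388–390 [PDF 34–36]: the paper-internal bookkeeping implication "(1.97) ⇐ (1.92), (1.93),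
(1.94), (1.96) and the five smallness clauses of pp. 388–389" KERNEL-CHECKED, concluding unit b02's quoted leaf
`B16.Ineq197` BY NAME — the input of the sibling `B16Exp198.Geometry.ineq199_of_ineq197` ((1.97) ⇒ (1.98)–(1.99)), whose
header lists exactly this edge as *"NOT TYPED HERE: … the activity estimates (1.92)–(1.97)"*.

CITATION HEADER (lean-in-tree rule 2026-08-18).  Source: [Balaban1989LargeFieldII] as above, doi:10.1007/bf01257421;
every quotation below is read from the page renders `…1989-cmp122-large-field-II-p033/p034/p035/p036-x2.png` (pp. 387–390)
READ AS IMAGES by the writing seat.  The Bałaban papers are manuscripts UNDER ADJUDICATION by the audit cell `pub-balaban`: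
nothing printed in them is asserted here.  The displayed inputs enter as HYPOTHESES (`Prop`-valued leaves with the printed
formula in the docstring), the displayed output is the sibling's `B16.Ineq197`; every `theorem` is finite combinatorics or
real arithmetic over an ABSTRACT index catalogue, proved without `sorry` and without new axioms.  NEW sibling module of
unit `b2b-balaban-b02` (gen 14); it imports `…B16Exp198` (hence `…B16`) and `…B16Cor3` (only for the folklore
`B16Cor3.sum_powerset_prod_le_exp`, Σ_{W⊆s}Π w ≤ exp Σ w) and modifies nothing.  Cell records: GAPS.md
C-B16-7 (b02, exponent bookkeeping of (1.90)–(1.97)), C-adv6-51 (junction/coefficient accounting of (1.93)), C-adv7-84…87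
((1.94)–(1.97), the «+1», the c₁-selector), G-adv3-21 (OPEN objection on the V(X~)-half of σ — see `Consts.s` below),
G-B16-07 R9–R11, SMALLNESS.md S-B16.12 / S-B16.13 / S-B16.19; the scratch kernels `HOME/b2b-balaban-adv6/g28/Junction388.lean`
and `HOME/b2b-balaban-adv7/g41/Adv7G41.lean` (Mathlib-only, not in the tree) checked single clauses of the same pages; this
module is the tree-level composition ending in the quoted leaf.

## What is printed (verbatim)

p. 388 [34]: *"where the activities F(X′) are defined by F(X′) = Σ_q Σ′_{{X_{j_1},…,X_{j_q}}} Σ′_𝐃 Π_{Y∈𝐃} ∫₀¹dt(Y)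
Π_{h=1}^q 𝐓′_k(X_{j_h}) Π_{Y∈𝐃} V(Y) exp Σ_{Y∈𝐃} t(Y)V(Y). (1.91) Here the summation is over {X_{j_1},…,X_{j_q}} and 𝐃
such that the connected localization domain they determine is equal to X′. To get a convergent exponentiated expansion of
the right-hand side of (1.90), we have to obtain the bounds for the activities. Using (1.68), (1.73), (1.89), we obtain
|F(X′)| ≤ Σ_q Σ′_{{X_{j_1},…,X_{j_q}}} Σ′_𝐃 Π_{h=1}^q exp(−2(1+β₀)⁻¹p₀(g_k) + 1) · (Π_{Y∈𝐃} α exp(−(1+2β)κ d_{k,Z′}(Y)))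
exp Σ_{Y∈𝐃} α exp(−(1+2β)κ d_{k,Z′}(Y)), (1.92) where Z′ = ⋃_{i=1}^m Y_i ∪ ⋃_{h=1}^q X_{j_h}, and we have estimated the
expression |σ| in (1.73) by 1. We estimate the second product above in the following way: Π_{Y∈𝐃} α exp(−(1+2β)κ
d_{k,Z′}(Y)) ≤ exp(−(1+β)κ d_{k,∪Y_i}(X′)) exp(−(3·2^d)⁻¹βκM^{−d}|X′∖∪Y_i|) · Π_{h=1}^q exp((1 + β + (3·2^d)⁻¹β)
κM^{−d}|X_{j_h}|) Π_{Y∈𝐃} α^{2/3} exp(−½βκ d_{k,Z′}(Y)), (1.93) where we have used the fact that α is sufficiently small,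
e.g., α^{1/3} ≤ exp(−(1+β)κ2d), to produce the exponential factors connecting graphs in domains Y, in the cases they
intersect outside Z′. The sum of the last products above is estimated in the usual way: Σ_𝐃 Π_{Y∈𝐃} α^{2/3} exp(−½βκ
d_{k,Z′}(Y)) = Σ_n (1/n!) Σ′_{(Y_1,…,Y_n)} Π_{j=1}^n α^{2/3} exp(−½βk d_{k,Z′}(Y)) ≤ c₀ exp Σ_{Y⊂X′} α^{1/3} exp(−½βκ
d_{k,Z′}(Y))"*; p. 389 [35]: *"≤ c₀ exp(Σ_{i:Y_i⊂X′} O(1)α^{1/3}M^{−d+1}|∂Y_i ∩ ∂(X′∖Y_i)| + Σ_{h=1}^q O(1)α^{1/3}M^{−d+1}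
|∂X_{j_h} ∩ ∂(X′∖X_{j_h})|) ≤ c₀ exp O(1)α^{1/3}M^{−d}|X′∖Z′|, (1.94) where c₀ = 1, if the empty subfamily is admissible in
the sum over 𝐃, and c₀ = α^{1/3} in the remaining cases. The first case is possible, if X′ is one of the domains X~_j, and
then we have the small factor from the bound (1.89) of the operation 𝐓′_k(X_j). The last exponential on the right-hand side
of (1.92) can be also estimated by the above bound. We have |X′∖Z′| ≤ |X′∖∪Y_i|, and we use the fact that O(1)α^{1/3} ≤ 1 ≤
1/(6·2^d)βκ for κ large enough, hence the above bound is cancelled by the corresponding part of the second factor on the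
right-hand side of (1.93). The product over h there is estimated by Π_{h=1}^q exp 2κ(100R_k)^d, and this product is
combined with the first product on the right-hand side of (1.92). We assume that g_k is so small that −2(1+β₀)⁻¹p₀(g_k) + 1
+ 2κ(100R_k)^d ≤ −(3/2)p₀(g_k) (for example, take β₀ = 1/7, then this means that −(1/4)p₀(g_k) + 1 + 2κ(100R_k)^d ≤ 0, and
before we had stronger restrictions on p₀(g_k)). Combining together all the estimates we obtain |F(X′)| ≤ Σ_q
Σ′_{{X_{j_1},…,X_{j_q}}} exp(−q(3/2)p₀(g_k))c₀ · exp(−(1+β)κ d_{k,∪Y_i}(X′)) exp(−(6·2^d)⁻¹βκM^{−d}|X′∖∪Y_i|). (1.95) Now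
there are two cases to consider. Either the domain X′ contains one of the domains Y_i, then the sum over q above begins with
q = 0, but then c₀ = α^{1/3}, or the domain X′ is disjoint with ⋃_{i=1}^m Y_i, and then the sum begins with q = 1. In the last
case we extract the factor exp(−p₀(g_k)) before the sum, and in both cases we estimate the obtained sum by Σ_{q≥0}
Σ′_{{X_{j_1},…,X_{j_q}}} exp(−q½p₀(g_k)) ≤ Σ_{q≥0} (1/q!) Σ′_{(X_{j_1},…,X_{j_q})} exp(−q½p₀(g_k)) ≤ exp(exp(−½p₀(g_k))
100^d(MR_k)^{−d}|X′∖∪Y_i|). (1.96) Finally, we have exp(−½p₀(g_k))100^dR_k^{−d} < exp(−½p₀(g_k)) ≤ (6·2^d)⁻¹βκ for g_k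
small, hence the above bound is cancelled by the last exponential in (1.95), and we obtain |F(X′)| ≤ c₁ exp(−(1+β)κ
d_{k,∪Y_i}(X′)), (1.97)"*; p. 390 [36] l. 1: *"where c₁ = exp(−p₀(g_k)) if X′ does not intersect ⋃_{i=1}^m Y_i, and c₁ =
α^{1/3} in the remaining cases."*

## The typed reading (cell DIVERGENCE D-b02.8 "schematic typing"; this module's row D-b02g14.1)

ONE polymer X′ at a time.  `Polymer LF DomY`: the resummed sum (1.91) is a FINITE sum over PAIRS p = (S, 𝐃) — S =
{X_{j_1},…,X_{j_q}} a set of class-1 components inside X′ (q = #S, drawn from the finite candidate set `cand`, print: the X_j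
⊂ X′∖⋃Y_i), 𝐃 a subfamily of the finite set `Ycat` of localization domains Y ⊂ X′ that can occur (each has Y∖Z~ ≠ ∅, p. 377,
so (1.68) applies; each meets X′∖Z′, cell C-adv7-85 (b)) — restricted to the admissible set `adm` (*"such that the connected
localization domain they determine is equal to X′"*); the real data d_{k,∪Y_i}(X′) (`dX`), M^{−d}|X′∖⋃Y_i| (`v`), d_{k,Z′}(Y)
= d_{k,Z}(Y) for Y ⊂ X′ (`dY`; Z ∩ X′ ⊆ Z′ ⊆ Z, cell C-B16-7 / C-adv7-85 (a)), and per class-1 component its tree cost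
(`treeX`, print M^{−d}|X_{j_h}| plus the entry connector) and volume M^{−d}|X_{j_h}| (`vol`).  `Consts`: α, β, κ (as in
`B16.Ineq197`), p₀(g_k) (`p0`), β₀, the σ-bound `s` of (1.73) (print: *"we have estimated the expression |σ| in (1.73) by
1"*, i.e. s = 1 — kept as a PARAMETER because the V(X~)-half of that estimate is the cell's OPEN objection G-adv3-21; the
only place s is consumed is the budget clause, which at β₀ = 1/7 reads s + E ≤ ¼p₀(g_k), `budget_iff_of_seventh`), the
per-component exponent `E` (print 2κ(100R_k)^d), the volume rate `lam` (print (3·2^d)⁻¹) and the linear cube count "a tree of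
length ℓ relative to Z′ meets ≤ a₁ℓ + a₀ M-cubes of Y∖Z′" (print's rate presupposes a₁ = 3·2^{d−1}, a₀ = 2^d — p. 385; the
cell's PROVED counts are a₁ = 4·2^d (`TreeLength.card_le_of_sAdmissible_len`: #cubes ≤ 2^d(4ℓ + 1)) and 2·2^d (cell C-adv6-49),
for which the same argument runs with lam = (8·2^d)⁻¹ resp. (4·2^d)⁻¹: cell C-adv6-51 (4) `coeff_cell`, S-B16.12 ⟦v2.26⟧ (c),
`B16SupCountFloor`), the junction cost `cJ` (print 2d), the anchored
constant `C₁` (print's O(1)) and the candidate density `ρ` (print 100^dR_k^{−d}).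

THE LEAVES (hypotheses): `Major192` = the displayed majorant (1.92) per term, with Π_h exp(−2(1+β₀)⁻¹p₀(g_k) + s) (DERIVED in
Part B from the schematic operator bound (1.73)·(1.89) `OpBound173` and the (1.68)-shaped sup bounds, with the by-name edges
`t1_of_fundIneq189 : Step.FundIneq189 …` and `a_of_ineq168 : B16.Ineq168 …`); `Subadd193` = the relative tree subadditivity
behind (1.93) (d_{k,∪Y_i}(X′) ≤ Σ_{Y∈𝐃}(d_{k,Z′}(Y) + cJ) + Σ_h treeX(X_{j_h}): gluing the trees of the Y's and of the X_{j_h}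
through junctions OUTSIDE Z′ — print's sentence after (1.93); cell C-adv6-51 (1)–(3)); `Vol193` = the volume count behind
(1.93) (M^{−d}|X′∖⋃Y_i| ≤ Σ_{Y∈𝐃}(a₁d_{k,Z′}(Y) + a₀) + Σ_h M^{−d}|X_{j_h}|); `XBudget` = *"The product over h there is
estimated by Π_h exp 2κ(100R_k)^d"* ((1+β)κ·treeX + lam·βκ·vol ≤ E per component); `Anch194` = the anchored sum (1.94)
(Σ_{Y∈Ycat} α^{1/3}e^{−½βκ d(Y)} ≤ C₁α^{1/3}·v — the relative anchored bound K(κ), unit b01's `B14.RelAnimal`, times the 2d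
faces per outside cube; cell C-adv7-85 (c)–(d)); `Count196` = the count behind (1.96) (#cand ≤ ρ·v); and the two SELECTOR
facts of p. 389 ll. 17–21 (X′ ∩ ⋃Y_i ≠ ∅ ⇒ every admissible 𝐃 ≠ ∅, so c₀ = α^{1/3}; X′ ∩ ⋃Y_i = ∅ ⇒ every admissible q ≥ 1;
cell C-adv7-86).  THE SMALLNESS CLAUSES, all explicit (`Consts.Small`): 0 < α ≤ 1; *"α^{1/3} ≤ exp(−(1+β)κ2d)"* in the form
α^{1/3}·exp((1+β)κ·cJ + lam·βκ·a₀) ≤ 1 (one junction + the additive count defect per Y: S-B16.12 ⟦v2.26⟧ (c)); lam·a₁ ≤ ½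
(print: equality); the budget −2(1+β₀)⁻¹p₀ + s + E ≤ −(3/2)p₀ (S-B16.13; `B16.budget_beta0_iff`); *"O(1)α^{1/3} ≤ 1 ≤
(6·2^d)⁻¹βκ for κ large enough"* as 2C₁α^{1/3} ≤ ½lam·βκ (the O(1) absorbing the 2 of the two factors it cancels, cell
C-adv6-51 (5)); *"exp(−½p₀(g_k))100^dR_k^{−d} < … ≤ (6·2^d)⁻¹βκ for g_k small"* as exp(−½p₀)·ρ ≤ ½lam·βκ.

PROVED: (1.93) from `Subadd193` + `Vol193` + `XBudget` + the two α/lam clauses (`prod_a_le`: the split (1+2β) = (1+β) + ½β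
+ ½β and the exponent bookkeeping `exponent_193`); the estimate of the last exponential of (1.92) *"by the above bound"*
(`exp_sum_a_le`); (1.94)'s combinatorial half Σ_𝐃 Π ≤ Π(1 + ·) ≤ exp Σ with both values of c₀ (`sum_prod_w₂_le`: c₀ = 1;
`sum_prod_w₂_le_nonempty`: c₀ = α^{1/3} extracted from 𝐃 ≠ ∅); (1.95) per term (`norm_term_le`); (1.96) as the exact
binomial identity Σ_{S⊆cand} x^{#S} = (1 + x)^{#cand} ≤ exp(#cand·x) (`sum_powerset_pow_card_le_exp`) and the extraction
e^{−q(3/2)p₀} = e^{−qp₀}e^{−q½p₀} ≤ e^{−p₀}e^{−q½p₀} for q ≥ 1 (`sum_powerset_erase_pow_le`); the two cancellations and the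
two cases (`norm_sum_le_of_meets`: c₁ = α^{1/3}; `norm_sum_le_of_not_meets`: c₁ = e^{−p₀(g_k)}); and the edge
`ineq197_of_leaves : … → B16.Ineq197 S dom F p₀ α β κ` over unit b02's `B16.RelDomainSys` (d_{k,∪Y_i} = `S.dRel`, the
selector `S.MeetsLF`), composed with the sibling into `ineq199_of_leaves : … → B16.Ineq199 …` ((1.92)–(1.96) ⇒ (1.99)).
`toyPolymer`/`toyConsts` witness that the hypothesis bundle (all leaves + all clauses, one nonempty term) is satisfiable
in the case X′ ∩ ⋃Y_i ≠ ∅ (c₁ = α^{1/3}), and `toyPolymerB`/`toyConstsB` (Part G′, revision v1.1) in the case X′ ∩ ⋃Y_i = ∅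
(q ≥ 1, c₁ = e^{−p₀}; budget clause with equality, `XBudget` saturated, ρ = 1).  REVISION v1.1 (cross-read of v1 by unit
b2b-balaban-pv14-g12, cell GAPS C-pv14-77: verdict consistent, 0 objections): its one DOCFIX m1 folded (a surplus
parenthesis in the (1.96) quotation above); its note N1 recorded — the structure `Consts` of THIS module
(`B16Ineq197.Consts`, the thirteen bookkeeping constants of pp. 388–389) is unrelated to `Balaban1983to89.Consts` of the
cell's `Setup` module (the series' O(1) constants): qualify it when both namespaces are open; its note N3 (a branch-B toy,
built by the reader in `HOME/b2b-balaban-pv14/xread-b16/B16Copy_toyB.lean`) adopted as Part G′ below in this module's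
own notation.  No v1 declaration changed.
NOT TYPED HERE: the Mayer step (1.90)–(1.91) itself (the resummation producing `adm`), the lattice instances of the leaves
(joiner; b01's K(κ)), the operator content of (1.73) beyond `B16.ineq173` (one operation on a finite positive functional).
Value = kernel certificate of a paper-internal bookkeeping implication with its smallness clauses made explicit, NOT summit
progress.
-/

open Finset

noncomputable section

namespace Literature.MathematicalPhysics.QuantumFieldTheory.Balaban1983to89.B16Ineq197

/-! ## Part 0. Sums over subfamilies (the "usual way" of (1.94) and (1.96); `Σ_{W⊆s} Π_{Y∈W} w(Y) = Π(1 + w) ≤ exp Σ w` is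
unit b02's `B16Cor3.sum_powerset_prod_le_exp`, reused by name) -/

/-- The binomial identity behind (1.96): `Σ_{W ⊆ s} x^{#W} = (1 + x)^{#s}`. [folklore] -/
theorem sum_powerset_pow_card {ι : Type*} (s : Finset ι) (x : ℝ) :
    ∑ W ∈ s.powerset, x ^ W.card = (1 + x) ^ s.card := by
  classical
  have h := Finset.prod_one_add (f := fun _ : ι => x) s
  simp only [Finset.prod_const] at h
  exact h.symm

/-- (1.96), counting half: `Σ_{W ⊆ s} x^{#W} ≤ exp(#s · x)` for `x ≥ 0` (print: *"≤ Σ_{q≥0} (1/q!) Σ′_{(X_{j_1},…,X_{j_q})}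
exp(−q½p₀(g_k)) ≤ exp(exp(−½p₀(g_k)) · #candidates)"*). [cite: Balaban1989LargeFieldII, (1.96) p.389] -/
theorem sum_powerset_pow_card_le_exp {ι : Type*} (s : Finset ι) {x : ℝ} (hx : 0 ≤ x) :
    ∑ W ∈ s.powerset, x ^ W.card ≤ Real.exp (s.card * x) := by
  rw [sum_powerset_pow_card, Real.exp_nat_mul]
  exact pow_le_pow_left₀ (by linarith) (by linarith [Real.add_one_le_exp x]) _

/-- (1.96) with the extraction of p. 389: over NONEMPTY subfamilies, `Σ_{∅ ≠ W ⊆ s} (e·x)^{#W} ≤ e · exp(#s · x)` for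
`0 ≤ e ≤ 1`, `x ≥ 0` (print: *"then the sum begins with q = 1. In the last case we extract the factor exp(−p₀(g_k)) before
the sum"*: e = e^{−p₀(g_k)}, x = e^{−½p₀(g_k)}, e·x = e^{−(3/2)p₀(g_k)}). [cite: Balaban1989LargeFieldII, (1.96) p.389] -/
theorem sum_powerset_erase_pow_le {ι : Type*} [DecidableEq ι] (s : Finset ι) {x e : ℝ} (hx : 0 ≤ x) (he0 : 0 ≤ e)
    (he1 : e ≤ 1) : ∑ W ∈ s.powerset.erase ∅, (e * x) ^ W.card ≤ e * Real.exp (s.card * x) := by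
  calc ∑ W ∈ s.powerset.erase ∅, (e * x) ^ W.card ≤ ∑ W ∈ s.powerset.erase ∅, e * x ^ W.card := by
        refine Finset.sum_le_sum fun W hW => ?_
        have hne : W.card ≠ 0 :=
          Finset.card_ne_zero.2 (Finset.nonempty_iff_ne_empty.2 (Finset.mem_erase.1 hW).1)
        rw [mul_pow]
        exact mul_le_mul_of_nonneg_right (pow_le_of_le_one he0 he1 hne) (pow_nonneg hx _)
    _ ≤ ∑ W ∈ s.powerset, e * x ^ W.card :=
        Finset.sum_le_sum_of_subset_of_nonneg (Finset.erase_subset _ _) fun W _ _ =>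
          mul_nonneg he0 (pow_nonneg hx _)
    _ = e * ∑ W ∈ s.powerset, x ^ W.card := by rw [Finset.mul_sum]
    _ ≤ e * Real.exp (s.card * x) := mul_le_mul_of_nonneg_left (sum_powerset_pow_card_le_exp s hx) he0

/-- (1.94) with the extraction of `c₀ = α^{1/3}`: over NONEMPTY subfamilies and weights `c·(c·g(Y))` with `0 ≤ c ≤ 1`,
`g ≥ 0`: `Σ_{∅ ≠ D ⊆ t} Π_{Y∈D} c(c g(Y)) ≤ c · exp Σ_{Y∈t} c g(Y)` (print: *"c₀ = α^{1/3} in the remaining cases"*: one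
factor α^{1/3} of the α^{2/3} per Y is kept, c^{2n} ≤ c·c^n for n ≥ 1). [cite: Balaban1989LargeFieldII, (1.94) p.389] -/
theorem sum_powerset_erase_prod_le {ι : Type*} [DecidableEq ι] (t : Finset ι) {c : ℝ} (g : ι → ℝ) (hc0 : 0 ≤ c)
    (hc1 : c ≤ 1) (hg : ∀ Y ∈ t, 0 ≤ g Y) :
    ∑ D ∈ t.powerset.erase ∅, ∏ Y ∈ D, (c * (c * g Y)) ≤ c * Real.exp (∑ Y ∈ t, c * g Y) := by
  have hcg : ∀ Y ∈ t, 0 ≤ c * g Y := fun Y hY => mul_nonneg hc0 (hg Y hY)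
  calc ∑ D ∈ t.powerset.erase ∅, ∏ Y ∈ D, (c * (c * g Y))
      ≤ ∑ D ∈ t.powerset.erase ∅, c * ∏ Y ∈ D, (c * g Y) := by
        refine Finset.sum_le_sum fun D hD => ?_
        have hDne : D.card ≠ 0 :=
          Finset.card_ne_zero.2 (Finset.nonempty_iff_ne_empty.2 (Finset.mem_erase.1 hD).1)
        have hDt : D ⊆ t := Finset.mem_powerset.1 (Finset.mem_erase.1 hD).2
        rw [Finset.prod_mul_distrib, Finset.prod_const]
        exact mul_le_mul_of_nonneg_right (pow_le_of_le_one hc0 hc1 hDne)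
          (Finset.prod_nonneg fun Y hY => hcg Y (hDt hY))
    _ ≤ ∑ D ∈ t.powerset, c * ∏ Y ∈ D, (c * g Y) :=
        Finset.sum_le_sum_of_subset_of_nonneg (Finset.erase_subset _ _) fun D hD _ =>
          mul_nonneg hc0 (Finset.prod_nonneg fun Y hY => hcg Y (Finset.mem_powerset.1 hD hY))
    _ = c * ∑ D ∈ t.powerset, ∏ Y ∈ D, (c * g Y) := by rw [Finset.mul_sum]
    _ ≤ c * Real.exp (∑ Y ∈ t, c * g Y) := mul_le_mul_of_nonneg_left (B16Cor3.sum_powerset_prod_le_exp t _ hcg) hc0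

/-! ## Part A. The carriers: one polymer's term catalogue, the constants, the smallness clauses -/

variable {LF DomY : Type*}

/-- **One polymer X′ of (1.90)** — the index data of the resummed sum (1.91) and the sizes entering (1.92)–(1.96):
`cand` = the class-1 components X_j available inside X′ (outside ⋃Y_i); `Ycat` = the localization domains Y ⊂ X′ that can
occur in 𝐃 (Y∖Z~ ≠ ∅, p. 377: (1.68), not (1.69), applies to them); `adm` ⊆ {S ⊆ cand} × {𝐃 ⊆ Ycat} = *"the summation is
over {X_{j_1},…,X_{j_q}} and 𝐃 such that the connected localization domain they determine is equal to X′"*; `dX` =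
d_{k,∪Y_i}(X′); `v` = M^{−d}|X′∖⋃Y_i| ≥ 0; `dY Y` = d_{k,Z′}(Y) (= d_{k,Z}(Y) for Y ⊂ X′) ≥ 0; `treeX j` = the tree cost of
X_j inside the glued tree (print: M^{−d}|X_{j_h}|, plus its entry connector, cell S-B16.12), `vol j` = M^{−d}|X_j|.  Cube
geometry abstracted (cell DIVERGENCE D-b02.8). [cite: Balaban1989LargeFieldII, (1.91) p.388] -/
structure Polymer (LF DomY : Type*) where
  /-- the class-1 components X_j ⊂ X′∖⋃Y_i -/
  cand : Finset LF
  /-- the localization domains Y ⊂ X′ that can occur in 𝐃 -/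
  Ycat : Finset DomY
  /-- the admissible pairs ({X_{j_1},…,X_{j_q}}, 𝐃) -/
  adm : Finset (Finset LF × Finset DomY)
  /-- d_{k,∪Y_i}(X′) -/
  dX : ℝ
  /-- M^{−d}|X′∖⋃Y_i| -/
  v : ℝ
  /-- d_{k,Z′}(Y) -/
  dY : DomY → ℝ
  /-- tree cost of X_j (with its entry connector) -/
  treeX : LF → ℝ
  /-- M^{−d}|X_j| -/
  vol : LF → ℝ
  adm_fst : ∀ p ∈ adm, p.1 ⊆ cand
  adm_snd : ∀ p ∈ adm, p.2 ⊆ Ycat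
  v_nonneg : 0 ≤ v
  dY_nonneg : ∀ Y ∈ Ycat, 0 ≤ dY Y

/-- **The constants of pp. 388–389.** `α, β, κ` as in (1.68)/(1.97) (`B16.Ineq168`, `B16.Ineq197`); `p0` = p₀(g_k); `β₀` of
(1.89); `s` = the bound of |σ| used in (1.73) (print: 1; cell G-adv3-21); `E` = the per-component exponent (print:
2κ(100R_k)^d); `lam` = the volume rate of (1.93) (print: (3·2^d)⁻¹); `a₁`, `a₀` = the linear cube count of a tree (print's rate
presupposes 3·2^{d−1}, 2^d); `cJ` = junction cost (print: 2d); `C₁` = the O(1) of (1.94) (anchored constant × 2d faces);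
`ρ` = the candidate density of (1.96) (print: 100^dR_k^{−d}). [cite: Balaban1989LargeFieldII, pp.388-389] -/
structure Consts where
  /-- α of (1.68) -/
  α : ℝ
  /-- β of the tree-decay rates -/
  β : ℝ
  /-- κ -/
  κ : ℝ
  /-- p₀(g_k) -/
  p0 : ℝ
  /-- β₀ of (1.89) -/
  β₀ : ℝ
  /-- sup |σ| in (1.73) (print: 1) -/
  s : ℝ
  /-- per-component exponent (print: 2κ(100R_k)^d) -/
  E : ℝ
  /-- volume rate of (1.93) (print: (3·2^d)⁻¹) -/
  lam : ℝ
  /-- slope of the cube count (print: 3·2^{d−1}) -/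
  a₁ : ℝ
  /-- additive constant of the cube count (print: 2^d) -/
  a₀ : ℝ
  /-- junction cost (print: 2d) -/
  cJ : ℝ
  /-- the O(1) of (1.94) -/
  C₁ : ℝ
  /-- candidate density of (1.96) (print: 100^d R_k^{−d}) -/
  ρ : ℝ

namespace Consts

variable (K : Consts)

/-- The per-operation factor of (1.92): `exp(−2(1+β₀)⁻¹p₀(g_k) + s)` (print: `+ 1`). [cite: Balaban1989LargeFieldII, (1.92) p.388] -/
def θ : ℝ := Real.exp (-(2 * (1 + K.β₀)⁻¹ * K.p0) + K.s)

/-- The weight of (1.68)/(1.92): `a(d) = α exp(−(1+2β)κ d)`. [cite: Balaban1989LargeFieldII, (1.92) p.388] -/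
def a (d : ℝ) : ℝ := K.α * Real.exp (-((1 + 2 * K.β) * K.κ) * d)

/-- The residual weight of (1.93): `w₂(d) = α^{2/3} exp(−½βκ d)`. [cite: Balaban1989LargeFieldII, (1.93) p.388] -/
def w₂ (d : ℝ) : ℝ := K.α ^ (2 / 3 : ℝ) * Real.exp (-(K.β * K.κ / 2) * d)

/-- The anchored weight of (1.94): `w₁(d) = α^{1/3} exp(−½βκ d)`. [cite: Balaban1989LargeFieldII, (1.94) p.388] -/
def w₁ (d : ℝ) : ℝ := K.α ^ (1 / 3 : ℝ) * Real.exp (-(K.β * K.κ / 2) * d)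

/-- **The smallness clauses of pp. 388–389, explicit** (cell SMALLNESS.md S-B16.12, S-B16.13): signs; *"α is sufficiently
small, e.g., α^{1/3} ≤ exp(−(1+β)κ2d)"* as `junction` (one junction of cost cJ and the additive cube-count defect lam·βκ·a₀
per domain Y); `slope`: lam·a₁ ≤ ½ (print: (3·2^d)⁻¹ · 3·2^{d−1} = ½); `budget`: *"−2(1+β₀)⁻¹p₀(g_k) + 1 + 2κ(100R_k)^d ≤
−(3/2)p₀(g_k)"* with 1 ↦ s, 2κ(100R_k)^d ↦ E; `cancel_κ`: *"O(1)α^{1/3} ≤ 1 ≤ 1/(6·2^d)βκ for κ large enough"* (two factors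
cancelled against half of (1.93)'s volume factor); `cancel_g`: *"exp(−½p₀(g_k))100^dR_k^{−d} < exp(−½p₀(g_k)) ≤ (6·2^d)⁻¹βκ
for g_k small"* (cancelled against the other half, surviving in (1.95)). [cite: Balaban1989LargeFieldII, pp.388-389] -/
structure Small : Prop where
  α_pos : 0 < K.α
  α_le_one : K.α ≤ 1
  β_nonneg : 0 ≤ K.β
  κ_nonneg : 0 ≤ K.κ
  lam_nonneg : 0 ≤ K.lam
  p0_nonneg : 0 ≤ K.p0
  C₁_nonneg : 0 ≤ K.C₁
  junction : K.α ^ (1 / 3 : ℝ) * Real.exp ((1 + K.β) * K.κ * K.cJ + K.lam * K.β * K.κ * K.a₀) ≤ 1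
  slope : K.lam * K.a₁ ≤ 1 / 2
  budget : -(2 * (1 + K.β₀)⁻¹ * K.p0) + K.s + K.E ≤ -(3 / 2) * K.p0
  cancel_κ : 2 * K.C₁ * K.α ^ (1 / 3 : ℝ) ≤ K.lam * K.β * K.κ / 2
  cancel_g : Real.exp (-(K.p0 / 2)) * K.ρ ≤ K.lam * K.β * K.κ / 2

variable {K}

/-- `θ > 0`. [folklore] -/
theorem θ_pos : 0 < K.θ := Real.exp_pos _

/-- `a(d) ≥ 0` for `α ≥ 0`. [folklore] -/
theorem a_nonneg (hα : 0 ≤ K.α) (d : ℝ) : 0 ≤ K.a d := mul_nonneg hα (Real.exp_pos _).le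

/-- `w₁(d) ≥ 0` for `α ≥ 0`. [folklore] -/
theorem w₁_nonneg (hα : 0 ≤ K.α) (d : ℝ) : 0 ≤ K.w₁ d := mul_nonneg (Real.rpow_nonneg hα _) (Real.exp_pos _).le

/-- `w₂(d) ≥ 0` for `α ≥ 0`. [folklore] -/
theorem w₂_nonneg (hα : 0 ≤ K.α) (d : ℝ) : 0 ≤ K.w₂ d := mul_nonneg (Real.rpow_nonneg hα _) (Real.exp_pos _).le

/-- `w₂ = α^{1/3}·w₁` (α^{2/3} = α^{1/3}α^{1/3}). [folklore] -/
theorem w₂_eq (hK : K.Small) (d : ℝ) :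
    K.w₂ d = K.α ^ (1 / 3 : ℝ) * (K.α ^ (1 / 3 : ℝ) * Real.exp (-(K.β * K.κ / 2) * d)) := by
  have h : K.α ^ (2 / 3 : ℝ) = K.α ^ (1 / 3 : ℝ) * K.α ^ (1 / 3 : ℝ) := by
    rw [← Real.rpow_add hK.α_pos]; norm_num
  rw [w₂, h, mul_assoc]

/-- `w₂ ≤ w₁` (α^{2/3} ≤ α^{1/3} for 0 < α ≤ 1). [folklore] -/
theorem w₂_le_w₁ (hK : K.Small) (d : ℝ) : K.w₂ d ≤ K.w₁ d :=
  mul_le_mul_of_nonneg_right (Real.rpow_le_rpow_of_exponent_ge hK.α_pos hK.α_le_one (by norm_num))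
    (Real.exp_pos _).le

/-- `a ≤ w₁` on `d ≥ 0` (α ≤ α^{1/3}, (1+2β)κ ≥ ½βκ) — print: *"The last exponential on the right-hand side of (1.92) can be
also estimated by the above bound."* [cite: Balaban1989LargeFieldII, p.389] -/
theorem a_le_w₁ (hK : K.Small) {d : ℝ} (hd : 0 ≤ d) : K.a d ≤ K.w₁ d := by
  have h1 : K.α ≤ K.α ^ (1 / 3 : ℝ) := by
    have := Real.rpow_le_rpow_of_exponent_ge hK.α_pos hK.α_le_one (show (1 / 3 : ℝ) ≤ 1 by norm_num)
    rwa [Real.rpow_one] at this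
  have h2 : Real.exp (-((1 + 2 * K.β) * K.κ) * d) ≤ Real.exp (-(K.β * K.κ / 2) * d) := by
    apply Real.exp_le_exp.2
    have : 0 ≤ (1 + 3 * K.β / 2) * K.κ * d :=
      mul_nonneg (mul_nonneg (by linarith [hK.β_nonneg]) hK.κ_nonneg) hd
    nlinarith
  exact mul_le_mul h1 h2 (Real.exp_pos _).le (Real.rpow_nonneg hK.α_pos.le _)

/-- The combined per-component factor: `θ · e^{E} ≤ exp(−(3/2)p₀(g_k))` — print: *"this product is combined with the first
product on the right-hand side of (1.92). We assume that g_k is so small that −2(1+β₀)⁻¹p₀(g_k) + 1 + 2κ(100R_k)^d ≤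
−(3/2)p₀(g_k)"*. [cite: Balaban1989LargeFieldII, p.389] -/
theorem θE_le (hK : K.Small) : K.θ * Real.exp K.E ≤ Real.exp (-(3 / 2) * K.p0) := by
  rw [θ, ← Real.exp_add]
  exact Real.exp_le_exp.2 hK.budget

/-- `exp(−(3/2)p₀) = exp(−p₀) · exp(−½p₀)` — the split used in the two cases of p. 389. [folklore] -/
theorem exp_three_halves (p : ℝ) : Real.exp (-(3 / 2) * p) = Real.exp (-p) * Real.exp (-(p / 2)) := by
  rw [← Real.exp_add]; ring_nf

/-- The budget clause at the printed `β₀ = 1/7` with the σ-bound explicit: `−2(1+β₀)⁻¹p₀ + s + E ≤ −(3/2)p₀ ⟺ s + E ≤ ¼p₀`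
(print: *"take β₀ = 1/7, then this means that −(1/4)p₀(g_k) + 1 + 2κ(100R_k)^d ≤ 0"*; cell G-adv3-21 / C-adv7-87 (d): a
σ-bound s in place of 1 costs p₀(g_k) ≥ 4(s + 2κ(100R_k)^d)). [cite: Balaban1989LargeFieldII, p.389] -/
theorem budget_iff_of_seventh (p0 s E : ℝ) :
    -(2 * (1 + (1 / 7 : ℝ))⁻¹ * p0) + s + E ≤ -(3 / 2) * p0 ↔ s + E ≤ p0 / 4 := by
  have h : (2 * (1 + (1 / 7 : ℝ))⁻¹) = 7 / 4 := by norm_num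
  rw [h]
  constructor <;> intro h' <;> linarith

/-- The printed budget (s = 1, β₀ = 1/7) from unit b02's `B16.budget_beta0_iff`, by name. [cite: Balaban1989LargeFieldII, p.389] -/
theorem budget_of_printed (hβ₀ : K.β₀ = 1 / 7) (hs : K.s = 1) (h : 1 + K.E ≤ K.p0 / 4) :
    -(2 * (1 + K.β₀)⁻¹ * K.p0) + K.s + K.E ≤ -(3 / 2) * K.p0 := by
  have h' := (B16.budget_beta0_iff K.p0 K.E).2 h
  rw [hβ₀, hs]
  linarith

/-- The budget for any `0 ≤ β₀ ≤ 1/7` (s = 1) from unit b02's `B16.budget_beta0_le`, by name. [cite: Balaban1989LargeFieldII, p.389] -/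
theorem budget_of_le_seventh (h0 : 0 ≤ K.β₀) (h7 : K.β₀ ≤ 1 / 7) (hp : 0 ≤ K.p0) (hs : K.s = 1)
    (h : 1 + K.E ≤ K.p0 / 4) : -(2 * (1 + K.β₀)⁻¹ * K.p0) + K.s + K.E ≤ -(3 / 2) * K.p0 := by
  have h' := B16.budget_beta0_le K.β₀ K.p0 K.E h0 h7 hp h
  rw [hs]
  linarith

end Consts

namespace Polymer

variable (P : Polymer LF DomY) (K : Consts)

/-! ## Part A′. The leaves (hypotheses) -/

/-- **(1.92)** as the per-term majorant (print displayed above): for every admissible pair (S, 𝐃), `|term(S, 𝐃)| ≤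
θ^{#S} · Π_{Y∈𝐃} a(d(Y)) · exp Σ_{Y∈𝐃} a(d(Y))`, θ = exp(−2(1+β₀)⁻¹p₀(g_k) + s).  DERIVED in Part B from the schematic
operator bound; a hypothesis of Parts C–F. [cite: Balaban1989LargeFieldII, (1.92) p.388] -/
def Major192 (term : Finset LF × Finset DomY → ℂ) : Prop :=
  ∀ p ∈ P.adm, ‖term p‖ ≤ K.θ ^ p.1.card * (∏ Y ∈ p.2, K.a (P.dY Y)) * Real.exp (∑ Y ∈ p.2, K.a (P.dY Y))

/-- **The tree gluing behind (1.93)** (leaf): the relative size of X′ is at most the sum of the relative sizes of the Y ∈ 𝐃,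
one junction of cost ≤ cJ per Y, and the tree costs of the X_{j_h} — print: *"to produce the exponential factors connecting
graphs in domains Y, in the cases they intersect outside Z′"*; cell C-adv6-51 (1)–(3) (every pair of meeting members meets
OUTSIDE Z′; a spanning tree of the contact graph charges each Y its parent edge). [cite: Balaban1989LargeFieldII, (1.93) p.388] -/
def Subadd193 : Prop :=
  ∀ p ∈ P.adm, P.dX ≤ ∑ Y ∈ p.2, (P.dY Y + K.cJ) + ∑ j ∈ p.1, P.treeX j

/-- **The volume count behind (1.93)** (leaf): `M^{−d}|X′∖⋃Y_i| ≤ Σ_{Y∈𝐃} (a₁ d_{k,Z′}(Y) + a₀) + Σ_h M^{−d}|X_{j_h}|`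
(X′∖⋃Y_i ⊆ ⋃_{Y∈𝐃}(Y∖Z′) ∪ ⋃_h X_{j_h}, and a tree of length ℓ meets ≤ a₁ℓ + a₀ cubes; print's rate (3·2^d)⁻¹ presupposes
a₁ = 3·2^{d−1}, p. 385; cell C-adv6-51 (4), G-adv6-52/53). [cite: Balaban1989LargeFieldII, (1.93) p.388] -/
def Vol193 : Prop :=
  ∀ p ∈ P.adm, P.v ≤ ∑ Y ∈ p.2, (K.a₁ * P.dY Y + K.a₀) + ∑ j ∈ p.1, P.vol j

/-- **The per-component budget** (leaf): *"The product over h there is estimated by Π_{h=1}^q exp 2κ(100R_k)^d"* —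
`(1+β)κ·treeX(X_j) + lam·βκ·M^{−d}|X_j| ≤ E` (print: exp((1+β+(3·2^d)⁻¹β)κM^{−d}|X_{j_h}|) ≤ exp 2κ(100R_k)^d; the X_{j_h} sit
in cubes of size 64MR_k, p. 385 (1.81), and the ≤ q junctions falling on the X_{j_h} ride in the slack: cell C-adv6-51 (3),
scratch kernel `x_slack`). [cite: Balaban1989LargeFieldII, p.389] -/
def XBudget : Prop :=
  ∀ j ∈ P.cand, (1 + K.β) * K.κ * P.treeX j + K.lam * K.β * K.κ * P.vol j ≤ K.E

/-- **(1.94)** (leaf, the anchored sum): `Σ_{Y∈Ycat} α^{1/3} exp(−½βκ d_{k,Z′}(Y)) ≤ C₁ α^{1/3} M^{−d}|X′∖⋃Y_i|` — print's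
face sums *"Σ_i O(1)α^{1/3}M^{−d+1}|∂Y_i ∩ ∂(X′∖Y_i)| + Σ_h O(1)α^{1/3}M^{−d+1}|∂X_{j_h} ∩ ∂(X′∖X_{j_h})| ≤ O(1)α^{1/3}M^{−d}
|X′∖Z′|"* and *"|X′∖Z′| ≤ |X′∖∪Y_i|"*: the relative anchored bound (unit b01's `B14.RelAnimal.RelCubeSystem.sumsum`) times ≤ 2d
faces per outside cube (cell C-adv7-85 (c)–(d)). [cite: Balaban1989LargeFieldII, (1.94) p.389] -/
def Anch194 : Prop :=
  ∑ Y ∈ P.Ycat, K.w₁ (P.dY Y) ≤ K.C₁ * K.α ^ (1 / 3 : ℝ) * P.v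

/-- **The count behind (1.96)** (leaf): the number of class-1 components available inside X′∖⋃Y_i is `≤ ρ · M^{−d}|X′∖⋃Y_i|`
(print: ρ = 100^dR_k^{−d}; the X_j are disjoint and each contains an MR_k-cube, cell S-B16.13 ⟦v2.24⟧). [cite: Balaban1989LargeFieldII, (1.96) p.389] -/
def Count196 : Prop :=
  (P.cand.card : ℝ) ≤ K.ρ * P.v

/-! ## Part B. (1.91) ⇒ (1.92): "Using (1.68), (1.73), (1.89)" over a schematic term -/

/-- The integrand of (1.91) at interpolation parameters `t` and fixed fields: `Π_{Y∈𝐃} V(Y) · exp Σ_{Y∈𝐃} t(Y)V(Y)`. [cite: Balaban1989LargeFieldII, (1.91) p.388] -/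
def integrand (D : Finset DomY) (V : DomY → ℂ) (t : DomY → ℝ) : ℂ :=
  (∏ Y ∈ D, V Y) * Complex.exp (∑ Y ∈ D, (t Y : ℂ) * V Y)

/-- `|Π V(Y) · exp Σ t(Y)V(Y)| ≤ Π a(Y) · exp Σ a(Y)` when `|V(Y)| ≤ a(Y)` and `|t(Y)| ≤ 1` (the (1.68) half of (1.92):
`|e^{z}| = e^{Re z} ≤ e^{|z|}`). [folklore] -/
theorem norm_integrand_le (D : Finset DomY) (V : DomY → ℂ) (t : DomY → ℝ) (a : DomY → ℝ)
    (ht : ∀ Y ∈ D, |t Y| ≤ 1) (hV : ∀ Y ∈ D, ‖V Y‖ ≤ a Y) :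
    ‖integrand D V t‖ ≤ (∏ Y ∈ D, a Y) * Real.exp (∑ Y ∈ D, a Y) := by
  have ha : ∀ Y ∈ D, 0 ≤ a Y := fun Y hY => (norm_nonneg _).trans (hV Y hY)
  have h1 : ∏ Y ∈ D, ‖V Y‖ ≤ ∏ Y ∈ D, a Y := Finset.prod_le_prod (fun Y _ => norm_nonneg _) hV
  have h2 : (∑ Y ∈ D, (t Y : ℂ) * V Y).re ≤ ∑ Y ∈ D, a Y := by
    rw [Complex.re_sum]
    refine Finset.sum_le_sum fun Y hY => ?_
    calc ((t Y : ℂ) * V Y).re ≤ ‖(t Y : ℂ) * V Y‖ := Complex.re_le_norm _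
      _ = |t Y| * ‖V Y‖ := by rw [norm_mul, Complex.norm_real, Real.norm_eq_abs]
      _ ≤ 1 * a Y := mul_le_mul (ht Y hY) (hV Y hY) (norm_nonneg _) zero_le_one
      _ = a Y := one_mul _
  calc ‖integrand D V t‖ = (∏ Y ∈ D, ‖V Y‖) * Real.exp ((∑ Y ∈ D, (t Y : ℂ) * V Y).re) := by
        rw [integrand, norm_mul, Complex.norm_exp, norm_prod]
    _ ≤ (∏ Y ∈ D, a Y) * Real.exp (∑ Y ∈ D, a Y) :=
        mul_le_mul h1 (Real.exp_le_exp.2 h2) (Real.exp_pos _).le (Finset.prod_nonneg ha)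

/-- **(1.73) · (1.89), schematic** (leaf of Part B only): the term of (1.91) for the pair (S, 𝐃) is the t-average of the
operator `Π_{h} 𝐓′_k(X_{j_h})` applied to the integrand, and that operator maps an integrand bounded by `B` on the
integration domain `W` (for all interpolation parameters |t(Y)| ≤ 1) to a number bounded by `(Π_{j∈S} T1(j)·e^{s})·B`, where
`T1(j) = 𝐓′_k(X_j,(𝐔,0))1` and `s ≥ sup|σ|` — (1.73) p. 380: *"|𝐓′_k(X,(𝐔,𝐉))F| = |𝐓′_k(X,(𝐔,0)) e^{σ}F| ≤ 𝐓′_k(X,(𝐔,0))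
|e^{σ}F| ≤ (𝐓′_k(X,(𝐔,0))1) sup e^{|σ|}|F|"* (one operation on a finite positive functional is unit b02's `B16.ineq173`, whose
conclusion `(Σ_ω w_ω)·e^{s}·Fsup` is exactly the factor shape `T1(j)·e^{s}·B` below), iterated over h = 1,…,q and combined with
|∫₀¹dt(Y)| ≤ sup_{t∈[0,1]}. [cite: Balaban1989LargeFieldII, (1.73) p.380] -/
def OpBound173 {Ω : Type*} (W : Set Ω) (V : DomY → Ω → ℂ) (T1 : LF → ℝ) (s : ℝ)
    (term : Finset LF × Finset DomY → ℂ) : Prop :=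
  ∀ p ∈ P.adm, ∀ B : ℝ,
    (∀ t : DomY → ℝ, (∀ Y ∈ p.2, |t Y| ≤ 1) → ∀ ω ∈ W, ‖integrand p.2 (fun Y => V Y ω) t‖ ≤ B) →
      ‖term p‖ ≤ (∏ j ∈ p.1, T1 j * Real.exp s) * B

/-- (1.89) by name: unit f2's `Step.FundIneq189` for the region X_j gives the scalar input of `major192_of_opBound` at every
value of the remaining variables, with `p₀(g_k) = p0Profile A₀ p₀ g_k`. [cite: Balaban1989LargeFieldII, (1.89) p.387] -/
theorem t1_of_fundIneq189 {V' : Type*} (T1X : V' → ℝ) (A₀ : ℝ) (p₀ : ℕ) (β₀ gk : ℝ)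
    (h : Step.FundIneq189 T1X A₀ p₀ β₀ gk) (v : V') :
    T1X v ≤ Real.exp (-(2 * (1 + β₀)⁻¹ * p0Profile A₀ p₀ gk)) := h v

/-- (1.68) by name: unit b02's `B16.Ineq168` (over the relative system whose `dRel` is d_{k,Z}) gives the sup bound `|V(Y, ω)|
≤ a(d_{k,Z}(Y))` used in `major192_of_opBound`, for every Y outside the class "component of Z~" (p. 377: every Y of the sum
has Y∖Z~ ≠ ∅). [cite: Balaban1989LargeFieldII, (1.68) p.377] -/
theorem a_of_ineq168 (SZ : B16.RelDomainSys) (inside : SZ.Dom → Prop) {Ω : Type*} (domI : SZ.Dom → Set Ω)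
    (V : SZ.Dom → Ω → ℂ) (h : B16.Ineq168 SZ inside domI V K.α K.β K.κ) (Y : SZ.Dom) (hY : ¬ inside Y)
    (ω : Ω) (hω : ω ∈ domI Y) : ‖V Y ω‖ ≤ K.a (SZ.dRel Y) :=
  h Y hY ω hω

/-- **(1.91) ⇒ (1.92), PROVED over the schematic term**: the operator bound `OpBound173` with `0 ≤ T1(j) ≤
exp(−2(1+β₀)⁻¹p₀(g_k))` ((1.89)) for the components and `|V(Y, ω)| ≤ α exp(−(1+2β)κ d(Y))` ((1.68)) on the integration
domain give the displayed majorant `Major192`. [cite: Balaban1989LargeFieldII, (1.92) p.388] -/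
theorem major192_of_opBound {Ω : Type*} (W : Set Ω) (V : DomY → Ω → ℂ) (T1 : LF → ℝ)
    (term : Finset LF × Finset DomY → ℂ) (hop : P.OpBound173 W V T1 K.s term)
    (hT1 : ∀ j ∈ P.cand, 0 ≤ T1 j ∧ T1 j ≤ Real.exp (-(2 * (1 + K.β₀)⁻¹ * K.p0))) (hα : 0 ≤ K.α)
    (h168 : ∀ Y ∈ P.Ycat, ∀ ω ∈ W, ‖V Y ω‖ ≤ K.a (P.dY Y)) : P.Major192 K term := by
  intro p hp
  have hB := hop p hp ((∏ Y ∈ p.2, K.a (P.dY Y)) * Real.exp (∑ Y ∈ p.2, K.a (P.dY Y)))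
    (fun t ht ω hω => norm_integrand_le p.2 (fun Y => V Y ω) t (fun Y => K.a (P.dY Y)) ht
      (fun Y hY => h168 Y (P.adm_snd p hp hY) ω hω))
  have hθ : ∏ j ∈ p.1, T1 j * Real.exp K.s ≤ K.θ ^ p.1.card := by
    rw [← Finset.prod_const]
    refine Finset.prod_le_prod (fun j hj => mul_nonneg (hT1 j (P.adm_fst p hp hj)).1 (Real.exp_pos _).le)
      fun j hj => ?_
    rw [Consts.θ, Real.exp_add]
    exact mul_le_mul_of_nonneg_right (hT1 j (P.adm_fst p hp hj)).2 (Real.exp_pos _).le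
  have hnn : 0 ≤ (∏ Y ∈ p.2, K.a (P.dY Y)) * Real.exp (∑ Y ∈ p.2, K.a (P.dY Y)) :=
    mul_nonneg (Finset.prod_nonneg fun Y _ => Consts.a_nonneg hα _) (Real.exp_pos _).le
  calc ‖term p‖ ≤ (∏ j ∈ p.1, T1 j * Real.exp K.s) *
        ((∏ Y ∈ p.2, K.a (P.dY Y)) * Real.exp (∑ Y ∈ p.2, K.a (P.dY Y))) := hB
    _ ≤ K.θ ^ p.1.card * ((∏ Y ∈ p.2, K.a (P.dY Y)) * Real.exp (∑ Y ∈ p.2, K.a (P.dY Y))) :=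
        mul_le_mul_of_nonneg_right hθ hnn
    _ = _ := by ring

/-! ## Part C. (1.93), PROVED from the gluing, the volume count and the two α/lam clauses -/

/-- The exponent bookkeeping of (1.93) as pure real arithmetic: with `u = (1+β)κ`, `m = lam·βκ`, `h = ½βκ`, the per-Y
exponents `−(u·cJ + m·a₀) − (u + h)·d(Y)` sum to at most `−u·d(X′) − m·v + E·#S` under the gluing, the volume count, the
per-component budget and the slope clause `m·a₁·d ≤ h·d`. [cite: Balaban1989LargeFieldII, (1.93) p.388] -/
theorem exponent_193 {ι ι' : Type*} (D : Finset ι) (S : Finset ι') (dY : ι → ℝ) (treeX vol : ι' → ℝ)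
    (u m h cJ a₀ a₁ E dX v : ℝ) (hu : 0 ≤ u) (hm : 0 ≤ m)
    (hslope : ∀ Y ∈ D, m * a₁ * dY Y ≤ h * dY Y)
    (hS : dX ≤ ∑ Y ∈ D, (dY Y + cJ) + ∑ j ∈ S, treeX j)
    (hV : v ≤ ∑ Y ∈ D, (a₁ * dY Y + a₀) + ∑ j ∈ S, vol j)
    (hX : ∀ j ∈ S, u * treeX j + m * vol j ≤ E) :
    ∑ Y ∈ D, (-(u * cJ + m * a₀) - (u + h) * dY Y) ≤ -u * dX - m * v + E * S.card := by
  have h1 := mul_le_mul_of_nonneg_left hS hu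
  have h2 := mul_le_mul_of_nonneg_left hV hm
  have h3 : u * (∑ j ∈ S, treeX j) + m * (∑ j ∈ S, vol j) ≤ E * S.card := by
    rw [Finset.mul_sum, Finset.mul_sum, ← Finset.sum_add_distrib]
    have h := Finset.sum_le_sum hX
    rw [Finset.sum_const, nsmul_eq_mul] at h
    linarith
  have h4 : ∑ Y ∈ D, (-(u * cJ + m * a₀) - (u + h) * dY Y)
      ≤ ∑ Y ∈ D, (-(u * (dY Y + cJ)) - m * (a₁ * dY Y + a₀)) :=
    Finset.sum_le_sum fun Y hY => by linarith [hslope Y hY]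
  have h5 : ∑ Y ∈ D, (-(u * (dY Y + cJ)) - m * (a₁ * dY Y + a₀))
      = -(u * ∑ Y ∈ D, (dY Y + cJ)) - m * ∑ Y ∈ D, (a₁ * dY Y + a₀) := by
    rw [Finset.mul_sum, Finset.mul_sum, ← Finset.sum_neg_distrib, ← Finset.sum_sub_distrib]
  linarith [h1, h2, h3, h4, h5]

/-- The split of the (1.92) weight: `a(d) = [α^{1/3} exp(−((1+β)κ + ½βκ)d)] · w₂(d)` — print's identity (1+2β) = (1+β) + ½β +
½β with α = α^{1/3}·α^{2/3}. [cite: Balaban1989LargeFieldII, (1.93) p.388] -/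
theorem a_split (hK : K.Small) (d : ℝ) :
    K.a d = (K.α ^ (1 / 3 : ℝ) * Real.exp (-((1 + K.β) * K.κ + K.β * K.κ / 2) * d)) * K.w₂ d := by
  have hα : K.α = K.α ^ (1 / 3 : ℝ) * K.α ^ (2 / 3 : ℝ) := by
    rw [← Real.rpow_add hK.α_pos]; norm_num
  have he : Real.exp (-((1 + 2 * K.β) * K.κ) * d)
      = Real.exp (-((1 + K.β) * K.κ + K.β * K.κ / 2) * d) * Real.exp (-(K.β * K.κ / 2) * d) := by
    rw [← Real.exp_add]; ring_nf
  rw [Consts.a, Consts.w₂, he]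
  calc K.α * (Real.exp (-((1 + K.β) * K.κ + K.β * K.κ / 2) * d) * Real.exp (-(K.β * K.κ / 2) * d))
      = (K.α ^ (1 / 3 : ℝ) * K.α ^ (2 / 3 : ℝ)) *
          (Real.exp (-((1 + K.β) * K.κ + K.β * K.κ / 2) * d) * Real.exp (-(K.β * K.κ / 2) * d)) := by rw [← hα]
    _ = _ := by ring

/-- **(1.93), PROVED**: for every admissible pair, `Π_{Y∈𝐃} α exp(−(1+2β)κ d_{k,Z′}(Y)) ≤ exp(−(1+β)κ d_{k,∪Y_i}(X′)) ·
exp(−lam·βκ·M^{−d}|X′∖⋃Y_i|) · (e^{E})^{#S} · Π_{Y∈𝐃} α^{2/3} exp(−½βκ d_{k,Z′}(Y))` — the displayed (1.93) with the product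
over h already *"estimated by Π_{h=1}^q exp 2κ(100R_k)^d"* (E), from the leaves `Subadd193`, `Vol193`, `XBudget` and the clauses
`junction`, `slope` of `Consts.Small`. [cite: Balaban1989LargeFieldII, (1.93) p.388] -/
theorem prod_a_le (hK : K.Small) (hS : P.Subadd193 K) (hV : P.Vol193 K) (hX : P.XBudget K)
    {p : Finset LF × Finset DomY} (hp : p ∈ P.adm) :
    ∏ Y ∈ p.2, K.a (P.dY Y) ≤ Real.exp (-((1 + K.β) * K.κ) * P.dX) * Real.exp (-(K.lam * K.β * K.κ) * P.v)
      * Real.exp K.E ^ p.1.card * ∏ Y ∈ p.2, K.w₂ (P.dY Y) := by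
  have hu : 0 ≤ (1 + K.β) * K.κ := mul_nonneg (by linarith [hK.β_nonneg]) hK.κ_nonneg
  have hm : 0 ≤ K.lam * K.β * K.κ := mul_nonneg (mul_nonneg hK.lam_nonneg hK.β_nonneg) hK.κ_nonneg
  have hβκ : 0 ≤ K.β * K.κ := mul_nonneg hK.β_nonneg hK.κ_nonneg
  -- the junction clause as a bound on α^{1/3}
  have hc : K.α ^ (1 / 3 : ℝ) ≤ Real.exp (-((1 + K.β) * K.κ * K.cJ + K.lam * K.β * K.κ * K.a₀)) := by
    have hj := hK.junction
    calc K.α ^ (1 / 3 : ℝ)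
        = K.α ^ (1 / 3 : ℝ) * Real.exp ((1 + K.β) * K.κ * K.cJ + K.lam * K.β * K.κ * K.a₀)
            * Real.exp (-((1 + K.β) * K.κ * K.cJ + K.lam * K.β * K.κ * K.a₀)) := by
          rw [mul_assoc, ← Real.exp_add, add_neg_cancel, Real.exp_zero, mul_one]
      _ ≤ 1 * Real.exp (-((1 + K.β) * K.κ * K.cJ + K.lam * K.β * K.κ * K.a₀)) :=
          mul_le_mul_of_nonneg_right hj (Real.exp_pos _).le
      _ = _ := one_mul _
  -- the first factors, bounded termwise by exponentials
  have hfac : ∀ Y ∈ p.2,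
      K.α ^ (1 / 3 : ℝ) * Real.exp (-((1 + K.β) * K.κ + K.β * K.κ / 2) * P.dY Y)
        ≤ Real.exp (-((1 + K.β) * K.κ * K.cJ + K.lam * K.β * K.κ * K.a₀)
            - ((1 + K.β) * K.κ + K.β * K.κ / 2) * P.dY Y) := by
    intro Y hY
    rw [sub_eq_add_neg, Real.exp_add, ← neg_mul]
    exact mul_le_mul_of_nonneg_right hc (Real.exp_pos _).le
  have hexp : ∏ Y ∈ p.2, K.α ^ (1 / 3 : ℝ) * Real.exp (-((1 + K.β) * K.κ + K.β * K.κ / 2) * P.dY Y)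
      ≤ Real.exp (-((1 + K.β) * K.κ) * P.dX) * Real.exp (-(K.lam * K.β * K.κ) * P.v)
          * Real.exp K.E ^ p.1.card := by
    calc ∏ Y ∈ p.2, K.α ^ (1 / 3 : ℝ) * Real.exp (-((1 + K.β) * K.κ + K.β * K.κ / 2) * P.dY Y)
        ≤ ∏ Y ∈ p.2, Real.exp (-((1 + K.β) * K.κ * K.cJ + K.lam * K.β * K.κ * K.a₀)
            - ((1 + K.β) * K.κ + K.β * K.κ / 2) * P.dY Y) :=
          Finset.prod_le_prod (fun Y _ => mul_nonneg (Real.rpow_nonneg hK.α_pos.le _) (Real.exp_pos _).le) hfac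
      _ = Real.exp (∑ Y ∈ p.2, (-((1 + K.β) * K.κ * K.cJ + K.lam * K.β * K.κ * K.a₀)
            - ((1 + K.β) * K.κ + K.β * K.κ / 2) * P.dY Y)) := (Real.exp_sum _ _).symm
      _ ≤ Real.exp (-((1 + K.β) * K.κ) * P.dX - (K.lam * K.β * K.κ) * P.v + K.E * p.1.card) := by
          apply Real.exp_le_exp.2
          have key := exponent_193 p.2 p.1 P.dY P.treeX P.vol ((1 + K.β) * K.κ) (K.lam * K.β * K.κ)
            (K.β * K.κ / 2) K.cJ K.a₀ K.a₁ K.E P.dX P.v hu hm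
            (fun Y hY => by
              have hd : 0 ≤ P.dY Y := P.dY_nonneg Y (P.adm_snd p hp hY)
              have h1 : K.lam * K.a₁ * (K.β * K.κ) ≤ 1 / 2 * (K.β * K.κ) :=
                mul_le_mul_of_nonneg_right hK.slope hβκ
              have h2 := mul_le_mul_of_nonneg_right h1 hd
              calc K.lam * K.β * K.κ * K.a₁ * P.dY Y = K.lam * K.a₁ * (K.β * K.κ) * P.dY Y := by ring
                _ ≤ 1 / 2 * (K.β * K.κ) * P.dY Y := h2
                _ = K.β * K.κ / 2 * P.dY Y := by ring)
            (hS p hp) (hV p hp) (fun j hj => hX j (P.adm_fst p hp hj))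
          have e1 : ∀ Y ∈ p.2, (-((1 + K.β) * K.κ * K.cJ + K.lam * K.β * K.κ * K.a₀)
              - ((1 + K.β) * K.κ + K.β * K.κ / 2) * P.dY Y)
              = (-((1 + K.β) * K.κ * K.cJ + K.lam * K.β * K.κ * K.a₀)
                - ((1 + K.β) * K.κ + K.β * K.κ / 2) * P.dY Y) := fun _ _ => rfl
          linarith [key]
      _ = Real.exp (-((1 + K.β) * K.κ) * P.dX) * Real.exp (-(K.lam * K.β * K.κ) * P.v)
          * Real.exp K.E ^ p.1.card := by
          rw [← Real.exp_nat_mul, ← Real.exp_add, ← Real.exp_add]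
          congr 1; ring
  -- assemble with the split a = (…) · w₂
  have hsplit : ∏ Y ∈ p.2, K.a (P.dY Y)
      = (∏ Y ∈ p.2, K.α ^ (1 / 3 : ℝ) * Real.exp (-((1 + K.β) * K.κ + K.β * K.κ / 2) * P.dY Y))
          * ∏ Y ∈ p.2, K.w₂ (P.dY Y) := by
    rw [← Finset.prod_mul_distrib]
    exact Finset.prod_congr rfl fun Y _ => a_split K hK (P.dY Y)
  rw [hsplit]
  exact mul_le_mul_of_nonneg_right hexp (Finset.prod_nonneg fun Y _ => Consts.w₂_nonneg hK.α_pos.le _)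

/-! ## Part D. (1.94): the sum over 𝐃 and the last exponential of (1.92) -/

/-- The last exponential of (1.92) *"can be also estimated by the above bound"*: `exp Σ_{Y∈𝐃} a(d(Y)) ≤ exp(C₁α^{1/3}·v)`
(a ≤ w₁ termwise, 𝐃 ⊆ Ycat, `Anch194`). [cite: Balaban1989LargeFieldII, p.389] -/
theorem exp_sum_a_le (hK : K.Small) (h194 : P.Anch194 K) {p : Finset LF × Finset DomY} (hp : p ∈ P.adm) :
    Real.exp (∑ Y ∈ p.2, K.a (P.dY Y)) ≤ Real.exp (K.C₁ * K.α ^ (1 / 3 : ℝ) * P.v) := by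
  apply Real.exp_le_exp.2
  calc ∑ Y ∈ p.2, K.a (P.dY Y) ≤ ∑ Y ∈ p.2, K.w₁ (P.dY Y) :=
        Finset.sum_le_sum fun Y hY => Consts.a_le_w₁ hK (P.dY_nonneg Y (P.adm_snd p hp hY))
    _ ≤ ∑ Y ∈ P.Ycat, K.w₁ (P.dY Y) :=
        Finset.sum_le_sum_of_subset_of_nonneg (P.adm_snd p hp) fun Y _ _ => Consts.w₁_nonneg hK.α_pos.le _
    _ ≤ _ := h194

/-- **(1.94) with c₀ = 1**: `Σ_{𝐃 ⊆ Ycat} Π_{Y∈𝐃} α^{2/3}exp(−½βκ d(Y)) ≤ exp(C₁α^{1/3}·v)` (*"c₀ = 1, if the empty subfamily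
is admissible in the sum over 𝐃"*). [cite: Balaban1989LargeFieldII, (1.94) p.389] -/
theorem sum_prod_w₂_le (hK : K.Small) (h194 : P.Anch194 K) :
    ∑ D ∈ P.Ycat.powerset, ∏ Y ∈ D, K.w₂ (P.dY Y) ≤ Real.exp (K.C₁ * K.α ^ (1 / 3 : ℝ) * P.v) :=
  calc ∑ D ∈ P.Ycat.powerset, ∏ Y ∈ D, K.w₂ (P.dY Y) ≤ ∑ D ∈ P.Ycat.powerset, ∏ Y ∈ D, K.w₁ (P.dY Y) :=
        Finset.sum_le_sum fun _ _ => Finset.prod_le_prod (fun _ _ => Consts.w₂_nonneg hK.α_pos.le _)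
          fun _ _ => Consts.w₂_le_w₁ hK _
    _ ≤ Real.exp (∑ Y ∈ P.Ycat, K.w₁ (P.dY Y)) :=
        B16Cor3.sum_powerset_prod_le_exp _ _ fun _ _ => Consts.w₁_nonneg hK.α_pos.le _
    _ ≤ _ := Real.exp_le_exp.2 h194

/-- **(1.94) with c₀ = α^{1/3}**: over the NONEMPTY subfamilies, `Σ_{∅ ≠ 𝐃 ⊆ Ycat} Π_{Y∈𝐃} α^{2/3}exp(−½βκ d(Y)) ≤ α^{1/3}
exp(C₁α^{1/3}·v)` (*"and c₀ = α^{1/3} in the remaining cases"*). [cite: Balaban1989LargeFieldII, (1.94) p.389] -/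
theorem sum_prod_w₂_le_nonempty [DecidableEq DomY] (hK : K.Small) (h194 : P.Anch194 K) :
    ∑ D ∈ P.Ycat.powerset.erase ∅, ∏ Y ∈ D, K.w₂ (P.dY Y)
      ≤ K.α ^ (1 / 3 : ℝ) * Real.exp (K.C₁ * K.α ^ (1 / 3 : ℝ) * P.v) := by
  have hc0 : 0 ≤ K.α ^ (1 / 3 : ℝ) := Real.rpow_nonneg hK.α_pos.le _
  have hc1 : K.α ^ (1 / 3 : ℝ) ≤ 1 := Real.rpow_le_one hK.α_pos.le hK.α_le_one (by norm_num)
  have h := sum_powerset_erase_prod_le P.Ycat (c := K.α ^ (1 / 3 : ℝ))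
    (fun Y => Real.exp (-(K.β * K.κ / 2) * P.dY Y)) hc0 hc1 (fun Y _ => (Real.exp_pos _).le)
  calc ∑ D ∈ P.Ycat.powerset.erase ∅, ∏ Y ∈ D, K.w₂ (P.dY Y)
      = ∑ D ∈ P.Ycat.powerset.erase ∅, ∏ Y ∈ D,
          (K.α ^ (1 / 3 : ℝ) * (K.α ^ (1 / 3 : ℝ) * Real.exp (-(K.β * K.κ / 2) * P.dY Y))) :=
        Finset.sum_congr rfl fun D _ => Finset.prod_congr rfl fun Y _ => Consts.w₂_eq hK _
    _ ≤ K.α ^ (1 / 3 : ℝ) * Real.exp (∑ Y ∈ P.Ycat, K.α ^ (1 / 3 : ℝ) * Real.exp (-(K.β * K.κ / 2) * P.dY Y)) := h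
    _ ≤ K.α ^ (1 / 3 : ℝ) * Real.exp (K.C₁ * K.α ^ (1 / 3 : ℝ) * P.v) :=
        mul_le_mul_of_nonneg_left (Real.exp_le_exp.2 h194) hc0

/-! ## Part E. (1.95)–(1.97) for one polymer: the per-term bound, the two cancellations, the two cases -/

/-- **(1.95) per term**: (1.92) · (1.93) · the estimate of the last exponential give, for every admissible pair (S, 𝐃),
`|term(S, 𝐃)| ≤ e^{−(1+β)κ d(X′)} · (e^{−lam·βκ·v} e^{C₁α^{1/3}v}) · ((θe^{E})^{#S} · Π_{Y∈𝐃} w₂(d(Y)))`. [cite: Balaban1989LargeFieldII, (1.95) p.389] -/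
theorem norm_term_le (hK : K.Small) (hS : P.Subadd193 K) (hV : P.Vol193 K) (hX : P.XBudget K)
    (h194 : P.Anch194 K) {term : Finset LF × Finset DomY → ℂ} (h192 : P.Major192 K term)
    {p : Finset LF × Finset DomY} (hp : p ∈ P.adm) :
    ‖term p‖ ≤ Real.exp (-((1 + K.β) * K.κ) * P.dX)
      * (Real.exp (-(K.lam * K.β * K.κ) * P.v) * Real.exp (K.C₁ * K.α ^ (1 / 3 : ℝ) * P.v))
      * ((K.θ * Real.exp K.E) ^ p.1.card * ∏ Y ∈ p.2, K.w₂ (P.dY Y)) := by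
  have h1 := h192 p hp
  have h2 := prod_a_le P K hK hS hV hX hp
  have h3 := exp_sum_a_le P K hK h194 hp
  have hθn : 0 ≤ K.θ ^ p.1.card := pow_nonneg Consts.θ_pos.le _
  have hW : 0 ≤ ∏ Y ∈ p.2, K.w₂ (P.dY Y) := Finset.prod_nonneg fun Y _ => Consts.w₂_nonneg hK.α_pos.le _
  have hB : 0 ≤ Real.exp (-((1 + K.β) * K.κ) * P.dX) * Real.exp (-(K.lam * K.β * K.κ) * P.v)
      * Real.exp K.E ^ p.1.card * ∏ Y ∈ p.2, K.w₂ (P.dY Y) :=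
    mul_nonneg (mul_nonneg (mul_nonneg (Real.exp_pos _).le (Real.exp_pos _).le)
      (pow_nonneg (Real.exp_pos _).le _)) hW
  calc ‖term p‖ ≤ K.θ ^ p.1.card * (∏ Y ∈ p.2, K.a (P.dY Y)) * Real.exp (∑ Y ∈ p.2, K.a (P.dY Y)) := h1
    _ ≤ K.θ ^ p.1.card * (Real.exp (-((1 + K.β) * K.κ) * P.dX) * Real.exp (-(K.lam * K.β * K.κ) * P.v)
        * Real.exp K.E ^ p.1.card * ∏ Y ∈ p.2, K.w₂ (P.dY Y)) * Real.exp (∑ Y ∈ p.2, K.a (P.dY Y)) :=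
        mul_le_mul_of_nonneg_right (mul_le_mul_of_nonneg_left h2 hθn) (Real.exp_pos _).le
    _ ≤ K.θ ^ p.1.card * (Real.exp (-((1 + K.β) * K.κ) * P.dX) * Real.exp (-(K.lam * K.β * K.κ) * P.v)
        * Real.exp K.E ^ p.1.card * ∏ Y ∈ p.2, K.w₂ (P.dY Y)) * Real.exp (K.C₁ * K.α ^ (1 / 3 : ℝ) * P.v) :=
        mul_le_mul_of_nonneg_left h3 (mul_nonneg hθn hB)
    _ = _ := by rw [mul_pow]; ring

/-- The two cancellations of p. 389 as one exponent inequality: `e^{−lam·βκ·v} e^{C₁α^{1/3}v} · (e^{#cand·e^{−½p₀}} e^{C₁α^{1/3}v})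
≤ 1` from `Count196`, `cancel_κ` (*"O(1)α^{1/3} ≤ 1 ≤ 1/(6·2^d)βκ for κ large enough, hence the above bound is cancelled by the
corresponding part of the second factor on the right-hand side of (1.93)"*) and `cancel_g` (*"hence the above bound is
cancelled by the last exponential in (1.95)"*). [cite: Balaban1989LargeFieldII, p.389] -/
theorem cancellations (hK : K.Small) (h196 : P.Count196 K) :
    Real.exp (-(K.lam * K.β * K.κ) * P.v) * Real.exp (K.C₁ * K.α ^ (1 / 3 : ℝ) * P.v)
      * (Real.exp (P.cand.card * Real.exp (-(K.p0 / 2))) * Real.exp (K.C₁ * K.α ^ (1 / 3 : ℝ) * P.v)) ≤ 1 := by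
  have hN : (P.cand.card : ℝ) * Real.exp (-(K.p0 / 2)) ≤ K.lam * K.β * K.κ / 2 * P.v :=
    calc (P.cand.card : ℝ) * Real.exp (-(K.p0 / 2)) ≤ K.ρ * P.v * Real.exp (-(K.p0 / 2)) :=
          mul_le_mul_of_nonneg_right h196 (Real.exp_pos _).le
      _ = Real.exp (-(K.p0 / 2)) * K.ρ * P.v := by ring
      _ ≤ K.lam * K.β * K.κ / 2 * P.v := mul_le_mul_of_nonneg_right hK.cancel_g P.v_nonneg
  have hC : 2 * K.C₁ * K.α ^ (1 / 3 : ℝ) * P.v ≤ K.lam * K.β * K.κ / 2 * P.v :=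
    mul_le_mul_of_nonneg_right hK.cancel_κ P.v_nonneg
  rw [← Real.exp_add, ← Real.exp_add, ← Real.exp_add]
  apply Real.exp_le_one_iff.2
  linarith

/-- **(1.97), case X′ ∩ ⋃Y_i ≠ ∅** (*"Either the domain X′ contains one of the domains Y_i, then the sum over q above begins
with q = 0, but then c₀ = α^{1/3}"*): if every admissible 𝐃 is nonempty, `|Σ_{(S,𝐃)∈adm} term| ≤ α^{1/3} exp(−(1+β)κ
d_{k,∪Y_i}(X′))`. [cite: Balaban1989LargeFieldII, (1.97) p.389] -/
theorem norm_sum_le_of_meets [DecidableEq DomY] (hK : K.Small) (hS : P.Subadd193 K) (hV : P.Vol193 K) (hX : P.XBudget K)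
    (h194 : P.Anch194 K) (h196 : P.Count196 K) {term : Finset LF × Finset DomY → ℂ}
    (h192 : P.Major192 K term) (hA : ∀ p ∈ P.adm, p.2.Nonempty) :
    ‖∑ p ∈ P.adm, term p‖ ≤ K.α ^ (1 / 3 : ℝ) * Real.exp (-((1 + K.β) * K.κ) * P.dX) := by
  -- abbreviations of the proof: G = the term-independent factor, y = θe^E ≤ x = e^{−½p₀}
  have hsub : P.adm ⊆ P.cand.powerset ×ˢ (P.Ycat.powerset.erase ∅) := fun p hp =>
    Finset.mem_product.2 ⟨Finset.mem_powerset.2 (P.adm_fst p hp),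
      Finset.mem_erase.2 ⟨(hA p hp).ne_empty, Finset.mem_powerset.2 (P.adm_snd p hp)⟩⟩
  have hy0 : 0 ≤ K.θ * Real.exp K.E := mul_nonneg Consts.θ_pos.le (Real.exp_pos _).le
  have hx0 : 0 ≤ Real.exp (-(K.p0 / 2)) := (Real.exp_pos _).le
  have hyx : K.θ * Real.exp K.E ≤ Real.exp (-(K.p0 / 2)) := by
    refine (Consts.θE_le hK).trans (Real.exp_le_exp.2 ?_)
    linarith [hK.p0_nonneg]
  have hG : 0 ≤ Real.exp (-((1 + K.β) * K.κ) * P.dX)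
      * (Real.exp (-(K.lam * K.β * K.κ) * P.v) * Real.exp (K.C₁ * K.α ^ (1 / 3 : ℝ) * P.v)) :=
    mul_nonneg (Real.exp_pos _).le (mul_nonneg (Real.exp_pos _).le (Real.exp_pos _).le)
  have hW : ∀ D : Finset DomY, 0 ≤ ∏ Y ∈ D, K.w₂ (P.dY Y) := fun D =>
    Finset.prod_nonneg fun Y _ => Consts.w₂_nonneg hK.α_pos.le _
  have hSsum : ∑ S ∈ P.cand.powerset, (K.θ * Real.exp K.E) ^ S.card
      ≤ Real.exp (P.cand.card * Real.exp (-(K.p0 / 2))) :=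
    (Finset.sum_le_sum fun S _ => pow_le_pow_left₀ hy0 hyx _).trans (sum_powerset_pow_card_le_exp _ hx0)
  have hDsum := sum_prod_w₂_le_nonempty P K hK h194
  have hD0 : 0 ≤ ∑ D ∈ P.Ycat.powerset.erase ∅, ∏ Y ∈ D, K.w₂ (P.dY Y) := Finset.sum_nonneg fun D _ => hW D
  have hc0 : 0 ≤ K.α ^ (1 / 3 : ℝ) := Real.rpow_nonneg hK.α_pos.le _
  have hcanc := cancellations P K hK h196
  calc ‖∑ p ∈ P.adm, term p‖ ≤ ∑ p ∈ P.adm, ‖term p‖ := norm_sum_le _ _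
    _ ≤ ∑ p ∈ P.adm, Real.exp (-((1 + K.β) * K.κ) * P.dX)
          * (Real.exp (-(K.lam * K.β * K.κ) * P.v) * Real.exp (K.C₁ * K.α ^ (1 / 3 : ℝ) * P.v))
          * ((K.θ * Real.exp K.E) ^ p.1.card * ∏ Y ∈ p.2, K.w₂ (P.dY Y)) :=
        Finset.sum_le_sum fun p hp => norm_term_le P K hK hS hV hX h194 h192 hp
    _ ≤ ∑ p ∈ P.cand.powerset ×ˢ (P.Ycat.powerset.erase ∅), Real.exp (-((1 + K.β) * K.κ) * P.dX)
          * (Real.exp (-(K.lam * K.β * K.κ) * P.v) * Real.exp (K.C₁ * K.α ^ (1 / 3 : ℝ) * P.v))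
          * ((K.θ * Real.exp K.E) ^ p.1.card * ∏ Y ∈ p.2, K.w₂ (P.dY Y)) :=
        Finset.sum_le_sum_of_subset_of_nonneg hsub fun p _ _ =>
          mul_nonneg hG (mul_nonneg (pow_nonneg hy0 _) (hW _))
    _ = Real.exp (-((1 + K.β) * K.κ) * P.dX)
          * (Real.exp (-(K.lam * K.β * K.κ) * P.v) * Real.exp (K.C₁ * K.α ^ (1 / 3 : ℝ) * P.v))
          * ((∑ S ∈ P.cand.powerset, (K.θ * Real.exp K.E) ^ S.card)
            * ∑ D ∈ P.Ycat.powerset.erase ∅, ∏ Y ∈ D, K.w₂ (P.dY Y)) := by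
        rw [Finset.sum_product, Finset.sum_mul_sum, Finset.mul_sum]
        refine Finset.sum_congr rfl fun S _ => ?_
        rw [Finset.mul_sum]
    _ ≤ Real.exp (-((1 + K.β) * K.κ) * P.dX)
          * (Real.exp (-(K.lam * K.β * K.κ) * P.v) * Real.exp (K.C₁ * K.α ^ (1 / 3 : ℝ) * P.v))
          * (Real.exp (P.cand.card * Real.exp (-(K.p0 / 2)))
            * (K.α ^ (1 / 3 : ℝ) * Real.exp (K.C₁ * K.α ^ (1 / 3 : ℝ) * P.v))) :=
        mul_le_mul_of_nonneg_left (mul_le_mul hSsum hDsum hD0 (Real.exp_pos _).le) hG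
    _ = K.α ^ (1 / 3 : ℝ) * Real.exp (-((1 + K.β) * K.κ) * P.dX)
          * (Real.exp (-(K.lam * K.β * K.κ) * P.v) * Real.exp (K.C₁ * K.α ^ (1 / 3 : ℝ) * P.v)
            * (Real.exp (P.cand.card * Real.exp (-(K.p0 / 2))) * Real.exp (K.C₁ * K.α ^ (1 / 3 : ℝ) * P.v))) := by
        ring
    _ ≤ K.α ^ (1 / 3 : ℝ) * Real.exp (-((1 + K.β) * K.κ) * P.dX) * 1 :=
        mul_le_mul_of_nonneg_left hcanc (mul_nonneg hc0 (Real.exp_pos _).le)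
    _ = _ := mul_one _

/-- **(1.97), case X′ ∩ ⋃Y_i = ∅** (*"or the domain X′ is disjoint with ⋃_{i=1}^m Y_i, and then the sum begins with q = 1. In
the last case we extract the factor exp(−p₀(g_k)) before the sum"*): if every admissible S is nonempty, `|Σ_{(S,𝐃)∈adm} term|
≤ exp(−p₀(g_k)) exp(−(1+β)κ d_{k,∪Y_i}(X′))`. [cite: Balaban1989LargeFieldII, (1.97) p.389] -/
theorem norm_sum_le_of_not_meets [DecidableEq LF] (hK : K.Small) (hS : P.Subadd193 K) (hV : P.Vol193 K) (hX : P.XBudget K)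
    (h194 : P.Anch194 K) (h196 : P.Count196 K) {term : Finset LF × Finset DomY → ℂ}
    (h192 : P.Major192 K term) (hB : ∀ p ∈ P.adm, p.1.Nonempty) :
    ‖∑ p ∈ P.adm, term p‖ ≤ Real.exp (-K.p0) * Real.exp (-((1 + K.β) * K.κ) * P.dX) := by
  have hsub : P.adm ⊆ (P.cand.powerset.erase ∅) ×ˢ P.Ycat.powerset := fun p hp =>
    Finset.mem_product.2 ⟨Finset.mem_erase.2 ⟨(hB p hp).ne_empty, Finset.mem_powerset.2 (P.adm_fst p hp)⟩,
      Finset.mem_powerset.2 (P.adm_snd p hp)⟩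
  have hy0 : 0 ≤ K.θ * Real.exp K.E := mul_nonneg Consts.θ_pos.le (Real.exp_pos _).le
  have hx0 : 0 ≤ Real.exp (-(K.p0 / 2)) := (Real.exp_pos _).le
  have he0 : 0 ≤ Real.exp (-K.p0) := (Real.exp_pos _).le
  have he1 : Real.exp (-K.p0) ≤ 1 := Real.exp_le_one_iff.2 (by linarith [hK.p0_nonneg])
  have hyx : K.θ * Real.exp K.E ≤ Real.exp (-K.p0) * Real.exp (-(K.p0 / 2)) := by
    rw [← Consts.exp_three_halves]; exact Consts.θE_le hK
  have hG : 0 ≤ Real.exp (-((1 + K.β) * K.κ) * P.dX)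
      * (Real.exp (-(K.lam * K.β * K.κ) * P.v) * Real.exp (K.C₁ * K.α ^ (1 / 3 : ℝ) * P.v)) :=
    mul_nonneg (Real.exp_pos _).le (mul_nonneg (Real.exp_pos _).le (Real.exp_pos _).le)
  have hW : ∀ D : Finset DomY, 0 ≤ ∏ Y ∈ D, K.w₂ (P.dY Y) := fun D =>
    Finset.prod_nonneg fun Y _ => Consts.w₂_nonneg hK.α_pos.le _
  have hSsum : ∑ S ∈ P.cand.powerset.erase ∅, (K.θ * Real.exp K.E) ^ S.card
      ≤ Real.exp (-K.p0) * Real.exp (P.cand.card * Real.exp (-(K.p0 / 2))) :=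
    (Finset.sum_le_sum fun S _ => pow_le_pow_left₀ hy0 hyx _).trans (sum_powerset_erase_pow_le _ hx0 he0 he1)
  have hDsum := sum_prod_w₂_le P K hK h194
  have hD0 : 0 ≤ ∑ D ∈ P.Ycat.powerset, ∏ Y ∈ D, K.w₂ (P.dY Y) := Finset.sum_nonneg fun D _ => hW D
  have hcanc := cancellations P K hK h196
  calc ‖∑ p ∈ P.adm, term p‖ ≤ ∑ p ∈ P.adm, ‖term p‖ := norm_sum_le _ _
    _ ≤ ∑ p ∈ P.adm, Real.exp (-((1 + K.β) * K.κ) * P.dX)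
          * (Real.exp (-(K.lam * K.β * K.κ) * P.v) * Real.exp (K.C₁ * K.α ^ (1 / 3 : ℝ) * P.v))
          * ((K.θ * Real.exp K.E) ^ p.1.card * ∏ Y ∈ p.2, K.w₂ (P.dY Y)) :=
        Finset.sum_le_sum fun p hp => norm_term_le P K hK hS hV hX h194 h192 hp
    _ ≤ ∑ p ∈ (P.cand.powerset.erase ∅) ×ˢ P.Ycat.powerset, Real.exp (-((1 + K.β) * K.κ) * P.dX)
          * (Real.exp (-(K.lam * K.β * K.κ) * P.v) * Real.exp (K.C₁ * K.α ^ (1 / 3 : ℝ) * P.v))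
          * ((K.θ * Real.exp K.E) ^ p.1.card * ∏ Y ∈ p.2, K.w₂ (P.dY Y)) :=
        Finset.sum_le_sum_of_subset_of_nonneg hsub fun p _ _ =>
          mul_nonneg hG (mul_nonneg (pow_nonneg hy0 _) (hW _))
    _ = Real.exp (-((1 + K.β) * K.κ) * P.dX)
          * (Real.exp (-(K.lam * K.β * K.κ) * P.v) * Real.exp (K.C₁ * K.α ^ (1 / 3 : ℝ) * P.v))
          * ((∑ S ∈ P.cand.powerset.erase ∅, (K.θ * Real.exp K.E) ^ S.card)
            * ∑ D ∈ P.Ycat.powerset, ∏ Y ∈ D, K.w₂ (P.dY Y)) := by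
        rw [Finset.sum_product, Finset.sum_mul_sum, Finset.mul_sum]
        refine Finset.sum_congr rfl fun S _ => ?_
        rw [Finset.mul_sum]
    _ ≤ Real.exp (-((1 + K.β) * K.κ) * P.dX)
          * (Real.exp (-(K.lam * K.β * K.κ) * P.v) * Real.exp (K.C₁ * K.α ^ (1 / 3 : ℝ) * P.v))
          * ((Real.exp (-K.p0) * Real.exp (P.cand.card * Real.exp (-(K.p0 / 2))))
            * Real.exp (K.C₁ * K.α ^ (1 / 3 : ℝ) * P.v)) :=
        mul_le_mul_of_nonneg_left (mul_le_mul hSsum hDsum hD0 (mul_nonneg he0 (Real.exp_pos _).le)) hG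
    _ = Real.exp (-K.p0) * Real.exp (-((1 + K.β) * K.κ) * P.dX)
          * (Real.exp (-(K.lam * K.β * K.κ) * P.v) * Real.exp (K.C₁ * K.α ^ (1 / 3 : ℝ) * P.v)
            * (Real.exp (P.cand.card * Real.exp (-(K.p0 / 2))) * Real.exp (K.C₁ * K.α ^ (1 / 3 : ℝ) * P.v))) := by
        ring
    _ ≤ Real.exp (-K.p0) * Real.exp (-((1 + K.β) * K.κ) * P.dX) * 1 :=
        mul_le_mul_of_nonneg_left hcanc (mul_nonneg he0 (Real.exp_pos _).le)
    _ = _ := mul_one _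

end Polymer

/-! ## Part F. The edge to `B16.lean` and `B16Exp198`: (1.92)–(1.96) ⇒ `B16.Ineq197` ⇒ `B16.Ineq199` -/

/-- **(1.92)–(1.96) ⇒ (1.97) = unit b02's `B16.Ineq197`, PROVED** over the relative domain system `S` of `B16.lean` (d_{k,∪Y_i} =
`S.dRel`, the c₁-selector `S.MeetsLF X` = "X ∩ ⋃Y_i ≠ ∅"): for activities `F(X′, φ) = Σ_{(S,𝐃)∈adm(X′)} term(X′, (S,𝐃), φ)`
((1.91) resummed) whose terms obey the majorant (1.92) on the space `dom X′`, with the leaves `Subadd193`, `Vol193`, `XBudget`,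
`Anch194`, `Count196` for every polymer, the smallness clauses `Consts.Small`, and the two selector facts of p. 389 (X′ ∩ ⋃Y_i ≠
∅ ⇒ every admissible 𝐃 ≠ ∅; X′ ∩ ⋃Y_i = ∅ ⇒ every admissible q ≥ 1; cell C-adv7-86), the bound (1.97) holds with `c₁ =
exp(−p₀(g_k))` resp. `α^{1/3}` exactly as printed. [cite: Balaban1989LargeFieldII, (1.92)-(1.97) pp.388-390] -/
theorem ineq197_of_leaves [DecidableEq LF] [DecidableEq DomY] (S : B16.RelDomainSys) {Φ : Type*} (dom : S.Dom → Set Φ) (P : S.Dom → Polymer LF DomY)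
    (K : Consts) (hK : K.Small) (term : S.Dom → Finset LF × Finset DomY → Φ → ℂ) (F : S.Dom → Φ → ℂ)
    (hF : ∀ X, ∀ φ ∈ dom X, F X φ = ∑ p ∈ (P X).adm, term X p φ)
    (hdX : ∀ X, (P X).dX = S.dRel X)
    (h192 : ∀ X, ∀ φ ∈ dom X, (P X).Major192 K (fun p => term X p φ))
    (h193s : ∀ X, (P X).Subadd193 K) (h193v : ∀ X, (P X).Vol193 K) (hXB : ∀ X, (P X).XBudget K)
    (h194 : ∀ X, (P X).Anch194 K) (h196 : ∀ X, (P X).Count196 K)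
    (selA : ∀ X, S.MeetsLF X → ∀ p ∈ (P X).adm, p.2.Nonempty)
    (selB : ∀ X, ¬ S.MeetsLF X → ∀ p ∈ (P X).adm, p.1.Nonempty) :
    B16.Ineq197 S dom F K.p0 K.α K.β K.κ := by
  refine ⟨fun X hX φ hφ => ?_, fun X hX φ hφ => ?_⟩
  · rw [hF X φ hφ, ← hdX X]
    exact Polymer.norm_sum_le_of_not_meets (P X) K hK (h193s X) (h193v X) (hXB X) (h194 X) (h196 X)
      (h192 X φ hφ) (selB X hX)
  · rw [hF X φ hφ, ← hdX X]
    exact Polymer.norm_sum_le_of_meets (P X) K hK (h193s X) (h193v X) (hXB X) (h194 X) (h196 X)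
      (h192 X φ hφ) (selA X hX)

/-- **(1.92)–(1.96) ⇒ (1.99), end to end**: the previous theorem composed with the sibling's `B16Exp198.Geometry.ineq199_of_ineq197`
((1.97) ⇒ (1.98)–(1.99) by the tree-proved Kotecký–Preiss theorem) under that theorem's own clauses (space restriction, the
selector smallness e^{−p₀(g_k)} ≤ α^{1/3}, "κ large" ½βκ ≥ 2κ₀ + 2, "α small"). [cite: Balaban1989LargeFieldII, (1.92)-(1.99) pp.388-390] -/
theorem ineq199_of_leaves [DecidableEq LF] [DecidableEq DomY] (S : B16.RelDomainSys) {Cube : Type} [DecidableEq Cube] (G : B16Exp198.Geometry S Cube)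
    {Φ : Type*} (dom : S.Dom → Set Φ) (P : S.Dom → Polymer LF DomY) (K : Consts) (hK : K.Small)
    (term : S.Dom → Finset LF × Finset DomY → Φ → ℂ) (F : S.Dom → Φ → ℂ)
    (hF : ∀ X, ∀ φ ∈ dom X, F X φ = ∑ p ∈ (P X).adm, term X p φ)
    (hdX : ∀ X, (P X).dX = S.dRel X)
    (h192 : ∀ X, ∀ φ ∈ dom X, (P X).Major192 K (fun p => term X p φ))
    (h193s : ∀ X, (P X).Subadd193 K) (h193v : ∀ X, (P X).Vol193 K) (hXB : ∀ X, (P X).XBudget K)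
    (h194 : ∀ X, (P X).Anch194 K) (h196 : ∀ X, (P X).Count196 K)
    (selA : ∀ X, S.MeetsLF X → ∀ p ∈ (P X).adm, p.2.Nonempty)
    (selB : ∀ X, ¬ S.MeetsLF X → ∀ p ∈ (P X).adm, p.1.Nonempty)
    (hsp : ∀ X Z φ, G.cubes Z ⊆ G.cubes X → φ ∈ dom X → φ ∈ dom Z)
    (hr : 0 ≤ (1 + K.β / 2) * K.κ) (hpα : Real.exp (-K.p0) ≤ K.α ^ (1 / 3 : ℝ))
    (hlarge : (1 + K.β / 2) * K.κ + 2 * G.κ₀ + 2 ≤ (1 + K.β) * K.κ)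
    (hsmall : K.α ^ (1 / 3 : ℝ) * Real.exp ((1 + K.β / 2) * K.κ * G.c + 1) * G.K₀ * G.ν * G.c₀ ≤ 1) :
    B16.Ineq199 S dom (G.R' F) (Real.exp 1 * G.ν * G.c₀ * G.K₀ ^ 2) K.p0 K.α K.β K.κ :=
  G.ineq199_of_ineq197 dom F hsp hK.α_pos.le hr hpα hlarge hsmall
    (ineq197_of_leaves S dom P K hK term F hF hdX h192 h193s h193v hXB h194 h196 selA selB)

/-! ## Part G. Non-vacuity: one polymer on which every leaf and every clause holds, with a nonzero term -/

/-- Toy constants: α = 1/64 (α^{1/3} = 1/4), β = κ = lam = 1, p₀ = s = E = β₀ = 0, a₁ = 0, a₀ = 1, cJ = 0, C₁ = 1, ρ = 0.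
[folklore] -/
def toyConsts : Consts where
  α := 1 / 64
  β := 1
  κ := 1
  p0 := 0
  β₀ := 0
  s := 0
  E := 0
  lam := 1
  a₁ := 0
  a₀ := 1
  cJ := 0
  C₁ := 1
  ρ := 0

/-- `(1/64)^{1/3} = 1/4`. [folklore] -/
theorem toy_rpow : (1 / 64 : ℝ) ^ (1 / 3 : ℝ) = 1 / 4 := by
  rw [show (1 / 64 : ℝ) = (1 / 4) ^ (3 : ℕ) by norm_num, ← Real.rpow_natCast,
    ← Real.rpow_mul (by norm_num)]
  norm_num

/-- The toy constants satisfy every smallness clause (junction: ¼e ≤ 1). [folklore] -/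
theorem toy_small : toyConsts.Small where
  α_pos := by norm_num [toyConsts]
  α_le_one := by norm_num [toyConsts]
  β_nonneg := by norm_num [toyConsts]
  κ_nonneg := by norm_num [toyConsts]
  lam_nonneg := by norm_num [toyConsts]
  p0_nonneg := by norm_num [toyConsts]
  C₁_nonneg := by norm_num [toyConsts]
  junction := by
    simp only [toyConsts]
    rw [toy_rpow]
    have := Real.exp_one_lt_d9
    norm_num
    linarith
  slope := by norm_num [toyConsts]
  budget := by norm_num [toyConsts]
  cancel_κ := by
    simp only [toyConsts]
    rw [toy_rpow]
    norm_num
  cancel_g := by norm_num [toyConsts]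

/-- Toy polymer: no class-1 component, one domain Y, the single admissible pair (∅, {Y}); d(X′) = d(Y) = 0, v = 1. [folklore] -/
def toyPolymer : Polymer Unit Unit where
  cand := ∅
  Ycat := {()}
  adm := {(∅, {()})}
  dX := 0
  v := 1
  dY := fun _ => 0
  treeX := fun _ => 0
  vol := fun _ => 0
  adm_fst := fun p hp => by rw [Finset.mem_singleton.1 hp]
  adm_snd := fun p hp => by rw [Finset.mem_singleton.1 hp]
  v_nonneg := zero_le_one
  dY_nonneg := fun _ _ => le_rfl

/-- The toy term: the (1.92) majorant itself, `a(0)·e^{a(0)}`, a nonzero number. [folklore] -/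
def toyTerm : Finset Unit × Finset Unit → ℂ :=
  fun _ => ((toyConsts.a (toyPolymer.dY ()) * Real.exp (toyConsts.a (toyPolymer.dY ())) : ℝ) : ℂ)

/-- The toy term obeys (1.92) (with equality). [folklore] -/
theorem toy_major : toyPolymer.Major192 toyConsts toyTerm := by
  intro p hp
  have hp' : p = (∅, {()}) := Finset.mem_singleton.1 hp
  subst hp'
  have h0 : 0 ≤ toyConsts.a (toyPolymer.dY ()) * Real.exp (toyConsts.a (toyPolymer.dY ())) :=
    mul_nonneg (Consts.a_nonneg (by norm_num [toyConsts]) _) (Real.exp_pos _).le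
  simp only [toyTerm, Finset.card_empty, pow_zero, one_mul, Finset.prod_singleton, Finset.sum_singleton,
    Complex.norm_real, Real.norm_eq_abs, abs_of_nonneg h0, le_refl]

/-- A one-domain relative system in the case X′ ∩ ⋃Y_i ≠ ∅ (d_k = d_{k,∪Y_i} = 0). [folklore] -/
def toyRelDomainSys : B16.RelDomainSys where
  Dom := Unit
  dj := fun _ => 0
  dj_nonneg := fun _ => le_rfl
  dRel := fun _ => 0
  MeetsLF := fun _ => True
  dRel_nonneg := fun _ => le_rfl
  dRel_le := fun _ => le_rfl
  dRel_eq_of_not_meets := fun _ h => (h trivial).elim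

/-- **Non-vacuity of `ineq197_of_leaves`**: on the toy data every leaf, every clause and both selector facts hold and the term
is nonzero; the theorem then yields `B16.Ineq197` for the toy activity (|F| = (1/64)e^{1/64} ≤ ¼ = α^{1/3}). [folklore] -/
theorem toy_ineq197 :
    B16.Ineq197 toyRelDomainSys (fun _ => (Set.univ : Set Unit)) (fun _ _ => ∑ p ∈ toyPolymer.adm, toyTerm p)
      toyConsts.p0 toyConsts.α toyConsts.β toyConsts.κ :=
  ineq197_of_leaves toyRelDomainSys (fun _ => (Set.univ : Set Unit)) (fun _ => toyPolymer) toyConsts toy_small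
    (fun _ p _ => toyTerm p) (fun _ _ => ∑ p ∈ toyPolymer.adm, toyTerm p) (fun _ _ _ => rfl) (fun _ => rfl)
    (fun _ _ _ => toy_major)
    (fun _ p hp => by
      rw [Finset.mem_singleton.1 hp]
      simp [toyPolymer, toyConsts])
    (fun _ p hp => by
      rw [Finset.mem_singleton.1 hp]
      simp [toyPolymer, toyConsts])
    (fun _ j hj => absurd hj (by simp [toyPolymer]))
    (by
      intro _
      show ∑ Y ∈ toyPolymer.Ycat, toyConsts.w₁ (toyPolymer.dY Y) ≤ toyConsts.C₁ * toyConsts.α ^ (1 / 3 : ℝ) * toyPolymer.v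
      simp only [toyPolymer, toyConsts, Consts.w₁, Finset.sum_singleton]
      rw [toy_rpow]
      norm_num)
    (by
      intro _
      show ((toyPolymer.cand.card : ℕ) : ℝ) ≤ toyConsts.ρ * toyPolymer.v
      simp [toyPolymer, toyConsts])
    (fun _ _ p hp => by
      rw [Finset.mem_singleton.1 hp]
      exact ⟨(), Finset.mem_singleton_self _⟩)
    (fun _ h => (h trivial).elim)

/-! ## Part G′. Non-vacuity of the other branch (X′ ∩ ⋃Y_i = ∅, q ≥ 1, c₁ = e^{−p₀}; revision v1.1, cross-read note N3 of cell GAPS C-pv14-77) -/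

/-- Toy constants for the OTHER branch (X′ ∩ ⋃Y_i = ∅, c₁ = e^{−p₀}): α = 1/64, β = κ = lam = 1, p₀ = 2, β₀ = s = 0,
E = 1, a₁ = 0, a₀ = 1, cJ = 0, C₁ = 1, ρ = 1 — the budget clause holds with EQUALITY (−4 + 0 + 1 = −3), the component
budget `XBudget` is saturated (lam·βκ·1 = E) and `cancel_g` reads e^{−1} ≤ ½. [folklore] -/
def toyConstsB : Consts where
  α := 1 / 64
  β := 1
  κ := 1
  p0 := 2
  β₀ := 0
  s := 0
  E := 1
  lam := 1
  a₁ := 0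
  a₀ := 1
  cJ := 0
  C₁ := 1
  ρ := 1

/-- The branch-B toy constants satisfy every smallness clause. [folklore] -/
theorem toyB_small : toyConstsB.Small where
  α_pos := by norm_num [toyConstsB]
  α_le_one := by norm_num [toyConstsB]
  β_nonneg := by norm_num [toyConstsB]
  κ_nonneg := by norm_num [toyConstsB]
  lam_nonneg := by norm_num [toyConstsB]
  p0_nonneg := by norm_num [toyConstsB]
  C₁_nonneg := by norm_num [toyConstsB]
  junction := by
    simp only [toyConstsB]
    rw [toy_rpow]
    have := Real.exp_one_lt_d9
    norm_num
    linarith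
  slope := by norm_num [toyConstsB]
  budget := by norm_num [toyConstsB]
  cancel_κ := by
    simp only [toyConstsB]
    rw [toy_rpow]
    norm_num
  cancel_g := by
    simp only [toyConstsB]
    have h1 : Real.exp (-(2 / 2 : ℝ)) = (Real.exp 1)⁻¹ := by norm_num [Real.exp_neg]
    rw [h1]
    have := Real.exp_one_gt_d9
    rw [inv_mul_le_iff₀ (Real.exp_pos 1)]
    linarith

/-- Branch-B toy polymer: ONE class-1 component, no domain Y, the single admissible pair ({X₁}, ∅); d(X′) = 0, v = 1,
M^{−d}|X₁| = 1, tree size 0. [folklore] -/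
def toyPolymerB : Polymer Unit Unit where
  cand := {()}
  Ycat := ∅
  adm := {({()}, ∅)}
  dX := 0
  v := 1
  dY := fun _ => 0
  treeX := fun _ => 0
  vol := fun _ => 1
  adm_fst := fun p hp => by rw [Finset.mem_singleton.1 hp]
  adm_snd := fun p hp => by rw [Finset.mem_singleton.1 hp]
  v_nonneg := zero_le_one
  dY_nonneg := fun _ h => absurd h (Finset.notMem_empty _)

/-- The branch-B toy term: the (1.92) majorant itself, θ = e^{−4}, a nonzero number. [folklore] -/
def toyTermB : Finset Unit × Finset Unit → ℂ := fun _ => ((Real.exp (-4) : ℝ) : ℂ)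

/-- The branch-B toy term obeys (1.92) (with equality: θ^1 · 1 · e^0). [folklore] -/
theorem toyB_major : toyPolymerB.Major192 toyConstsB toyTermB := by
  intro p hp
  have hp' : p = ({()}, ∅) := Finset.mem_singleton.1 hp
  subst hp'
  simp only [toyTermB, Consts.θ, toyConstsB, Finset.card_singleton, pow_one, Finset.prod_empty, Finset.sum_empty,
    Real.exp_zero, mul_one, Complex.norm_real, Real.norm_eq_abs, abs_of_nonneg (Real.exp_pos _).le]
  norm_num

/-- A one-domain relative system in the case X′ ∩ ⋃Y_i = ∅ (d_k = d_{k,∪Y_i} = 0, `MeetsLF ≡ False`). [folklore] -/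
def toyRelDomainSysB : B16.RelDomainSys where
  Dom := Unit
  dj := fun _ => 0
  dj_nonneg := fun _ => le_rfl
  dRel := fun _ => 0
  MeetsLF := fun _ => False
  dRel_nonneg := fun _ => le_rfl
  dRel_le := fun _ => le_rfl
  dRel_eq_of_not_meets := fun _ _ => rfl

/-- **Non-vacuity of `ineq197_of_leaves`, branch B** (X′ ∩ ⋃Y_i = ∅, q ≥ 1, c₁ = e^{−p₀}): on the branch-B toy data every
leaf, every clause (budget with equality, `XBudget` saturated, `Count196` with ρ = 1) and both selector facts hold, the
term is nonzero, and the theorem yields `B16.Ineq197` (|F| = e^{−4} ≤ e^{−2} = e^{−p₀}). [folklore] -/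
theorem toyB_ineq197 :
    B16.Ineq197 toyRelDomainSysB (fun _ => (Set.univ : Set Unit)) (fun _ _ => ∑ p ∈ toyPolymerB.adm, toyTermB p)
      toyConstsB.p0 toyConstsB.α toyConstsB.β toyConstsB.κ :=
  ineq197_of_leaves toyRelDomainSysB (fun _ => (Set.univ : Set Unit)) (fun _ => toyPolymerB) toyConstsB toyB_small
    (fun _ p _ => toyTermB p) (fun _ _ => ∑ p ∈ toyPolymerB.adm, toyTermB p) (fun _ _ _ => rfl) (fun _ => rfl)
    (fun _ _ _ => toyB_major)
    (fun _ p hp => by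
      rw [Finset.mem_singleton.1 hp]
      simp [toyPolymerB, toyConstsB])
    (fun _ p hp => by
      rw [Finset.mem_singleton.1 hp]
      simp [toyPolymerB, toyConstsB])
    (fun _ j hj => by
      simp [toyPolymerB, toyConstsB])
    (by
      intro _
      show ∑ Y ∈ toyPolymerB.Ycat, toyConstsB.w₁ (toyPolymerB.dY Y) ≤ toyConstsB.C₁ * toyConstsB.α ^ (1 / 3 : ℝ) * toyPolymerB.v
      simp only [toyPolymerB, toyConstsB, Finset.sum_empty]
      rw [toy_rpow]
      norm_num)
    (by
      intro _
      show ((toyPolymerB.cand.card : ℕ) : ℝ) ≤ toyConstsB.ρ * toyPolymerB.v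
      simp [toyPolymerB, toyConstsB])
    (fun _ h => h.elim)
    (fun _ _ p hp => by
      rw [Finset.mem_singleton.1 hp]
      exact ⟨(), Finset.mem_singleton_self _⟩)

end Literature.MathematicalPhysics.QuantumFieldTheory.Balaban1983to89.B16Ineq197
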